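import Literature.Probability.LatticeModels.PlanarIsingTwoPointProofs
import Literature.Probability.LatticeModels.MedialInterfaceProofs
import Literature.Topology.Euclidean.PlanarStaircase
import HarnessLib

/-!
# Ratios of lattice functions from the convergence of their discrete logarithmic derivatives

Topic `Literature/Probability/LatticeModels`. Glue layer of the programme behind
`Literature.Probability.LatticeModels.chi_onePoint_rho` (Chelkak–Hongler–Izyurov 2015, "CHI15"),
formalising the step **Theorem 1.5 ⇒ Proposition 2.20** (CHI15 §2.8, proof of Prop. 2.20, p. 16:
"by Theorem 1.5, `log (𝔼[σ_{v_{j+1}}…]/𝔼[σ_{v_j}…]) = 2δ·[Re 𝒜_Ω(v_j;…) + o(1)]` with `o(1)`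
uniform in `j`. Consequently `log (𝔼[σ_{a₀'}…]/𝔼[σ_{a₀}…]) = 2δ ∑_j Re 𝒜_Ω(v_j;…) + o(1) →
∫ Re 𝒜 dx` … one can move the points along horizontal and vertical segments … by Remark 2.18 the
ratio of spin correlations at two adjacent spins tends to `1`, so we can assume all points white")
in an abstract, purely real-analytic form that does not mention the Ising model:

**Theorem** (`tendsto_ratio_of_logDerivative`). Let `U ⊆ ℂ` be open and connected, `ℓ : ℂ → ℝ`
of class `C¹` on `U`, and `P δ : ℤ² → ℝ₊` lattice functions (mesh `δ`). Suppose that, uniformly over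
lattice sites `v` with `δv` in any compact subset of `U`, as `δ → 0⁺`:
* (`hdiag`, CHI15 Thm 1.5 in the tree's orientation) for each of the four diagonal steps `s`,
  `(P δ (v + s) / P δ v - 1)/δ → Dℓ(δv)[s]` (the derivative of `ℓ` at `δv` along `s ∈ ℂ`), and
* (`hnn`, CHI15 Remark 2.18) for each of the four nearest-neighbour steps `e`, `P δ (v + e) / P δ v → 1`.
Then for `y' , y₀ ∈ U` and marked points `y(δ) → y₀`:
`P δ [y(δ)/δ] / P δ [y'/δ] → exp (ℓ y₀ - ℓ y')`.

(CHI's lattice `δ(1+i)ℤ²` is the tree's `δℤ²` turned by `45°`: CHI's steps `a ↦ a + 2δ`,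
`a ↦ a + 2iδ` between faces of the same colour are the tree's diagonal steps, and CHI's adjacent faces
`a + (1 ± i)δ` are the tree's nearest neighbours.) With `ℓ = log ⟨σ_· σ_x⟩⁺_Ω` (the explicit
function (1.2)–(1.3), `twoPointPlusCHI`) and `P δ v = 𝔼⁺_{Ω_δ}[σ_v σ_{[x/δ]}]` this is hypothesis
`hR` of `PlanarIsingTwoPointProofs.chi_onePoint_rho_of_ratios`; the identification of the limit in
`hdiag` with `Re[𝒜_Ω dz]` (CHI15 Remark 2.21, §2.7) is a separate, continuum computation.

## Proof

No Riemann sums are needed: along a lattice path of `O(1/δ)` diagonal steps and `O(1)`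
nearest-neighbour steps whose mesh points stay in a compact `K ⊆ U`, the telescoping sum of
`log (P(v_{j+1})/P(v_j)) - (ℓ(δv_{j+1}) - ℓ(δv_j))` is `o(1)` (`abs_log_ratio_sub_le_of_itinerary`):
each diagonal term is `δ·o(1)` by `hdiag`, `|log(1+u) - u| ≤ 2u²` and the mean value inequality for
`ℓ` (uniform continuity of `Dℓ` on a compact neighbourhood), each nearest-neighbour term is `o(1)` by
`hnn`. The path from `[y'/δ]` to `[y(δ)/δ]` follows a polygon inscribed in a continuous path from `y'`
to `y₀` in `U` (path-connectedness of open connected sets, a Lebesgue-number thickening, uniform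
continuity), each small chord `Δ = α(1+i) + β(1-i)` being realised by `≈ α/δ` steps `±(1,1)` and
`≈ β/δ` steps `±(1,-1)`, followed by the chord `y(δ) - y₀ → 0` and a bounded staircase.

## References

* D. Chelkak, C. Hongler, K. Izyurov, Ann. of Math. 181 (2015) = arXiv:1202.2838: Thm 1.5,
  Remark 2.18, Prop 2.20 and its proof (§2.8), Remark 2.21 — `ChelkakHonglerIzyurovAnnals2015`.
-/

noncomputable section

open Filter Topology Metric Set Real
open Literature.Probability.LatticeModels

namespace Literature.Probability.LatticeModels

namespace LatticeRatio

/-! ### Elementary bounds for the logarithm -/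

/-- `|log (1 + u) - u| ≤ 2u²` for `|u| ≤ 1/2`. [folklore] -/
theorem abs_log_one_add_sub_le {u : ℝ} (hu : |u| ≤ 1 / 2) : |Real.log (1 + u) - u| ≤ 2 * u ^ 2 := by
  rw [abs_le] at hu
  have h1 : 0 < 1 + u := by linarith
  have hup : Real.log (1 + u) ≤ u := by
    have := Real.log_le_sub_one_of_pos h1
    linarith
  have hlow : u - 2 * u ^ 2 ≤ Real.log (1 + u) := by
    have h2 := Real.one_sub_inv_le_log_of_pos h1
    have h3 : u - 2 * u ^ 2 ≤ 1 - (1 + u)⁻¹ := by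
      rw [show 1 - (1 + u)⁻¹ = u / (1 + u) by field_simp; ring]
      rw [le_div_iff₀ h1]
      nlinarith
    linarith
  rw [abs_le]
  constructor <;> nlinarith [sq_nonneg u]

/-- `|log (1 + u)| ≤ 2|u|` for `|u| ≤ 1/2`. [folklore] -/
theorem abs_log_one_add_le {u : ℝ} (hu : |u| ≤ 1 / 2) : |Real.log (1 + u)| ≤ 2 * |u| := by
  have h := abs_log_one_add_sub_le hu
  have h2 : 2 * u ^ 2 ≤ |u| := by
    have : u ^ 2 = |u| * |u| := by rw [← sq_abs, sq]
    rw [this]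
    nlinarith [abs_nonneg u]
  calc |Real.log (1 + u)| = |(Real.log (1 + u) - u) + u| := by ring_nf
    _ ≤ |Real.log (1 + u) - u| + |u| := abs_add_le _ _
    _ ≤ 2 * |u| := by linarith

/-! ### Steps and itineraries on `ℤ²` -/

/-- The four **diagonal steps** `(±1, ±1)`. [cite: ChelkakHonglerIzyurovAnnals2015, Thm. 1.5 (steps a ↦ a + 2δ, a + 2iδ of the rotated lattice)] -/
def diagSteps : Finset (Site 2) :=
  {cornerUnit 0 + cornerUnit 1, cornerUnit 1 + cornerUnit 2, cornerUnit 2 + cornerUnit 3, cornerUnit 3 + cornerUnit 0}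

/-- The four **nearest-neighbour steps**. [cite: ChelkakHonglerIzyurovAnnals2015, Remark 2.18] -/
def nnSteps : Finset (Site 2) := Finset.univ.image cornerUnit

/-- The sites visited by the itinerary `L` (a list of steps) from `a`, including `a`. [folklore] -/
def visits : Site 2 → List (Site 2) → List (Site 2)
  | a, [] => [a]
  | a, s :: L => a :: visits (a + s) L

/-- The start is visited. [folklore] -/
theorem mem_visits_self (a : Site 2) (L : List (Site 2)) : a ∈ visits a L := by
  cases L <;> simp [visits]

/-- The end is visited. [folklore] -/
theorem end_mem_visits (a : Site 2) (L : List (Site 2)) : a + L.sum ∈ visits a L := by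
  induction L generalizing a with
  | nil => simp [visits]
  | cons s L ih =>
    simp only [visits, List.sum_cons, List.mem_cons]
    right
    rw [← add_assoc]
    exact ih (a + s)

/-- Visits of a concatenation. [folklore] -/
theorem visits_append (a : Site 2) (L L' : List (Site 2)) :
    ∀ u ∈ visits a (L ++ L'), u ∈ visits a L ∨ u ∈ visits (a + L.sum) L' := by
  induction L generalizing a with
  | nil => intro u hu; right; simpa using hu
  | cons s L ih =>
    intro u hu
    simp only [List.cons_append, visits, List.mem_cons] at hu
    rcases hu with rfl | hu
    · left; simp [visits]
    · rcases ih (a + s) u hu with h | h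
      · left; simp only [visits, List.mem_cons]; right; exact h
      · right; simpa [List.sum_cons, add_assoc] using h

/-- Visits of a run of `n` equal steps: `a + j s`, `j ≤ n`. [folklore] -/
theorem mem_visits_replicate {a s u : Site 2} {n : ℕ} (hu : u ∈ visits a (List.replicate n s)) :
    ∃ j : ℕ, j ≤ n ∧ u = a + j • s := by
  induction n generalizing a with
  | zero => simp [visits] at hu; exact ⟨0, le_rfl, by simp [hu]⟩
  | succ n ih =>
    simp only [List.replicate_succ, visits, List.mem_cons] at hu
    rcases hu with rfl | hu
    · exact ⟨0, by omega, by simp⟩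
    · obtain ⟨j, hj, rfl⟩ := ih hu
      exact ⟨j + 1, by omega, by rw [add_smul, one_smul, add_assoc, add_comm s]⟩

/-! ### The core estimate along an itinerary -/

/-- **Telescoping along an itinerary.** If every diagonal step from a visited site costs at most
`δ η₁` and every nearest-neighbour step at most `η₂` (discrepancy between `log`-ratio of `P` and
increment of `ℓ`), then along an itinerary of diagonal and nearest-neighbour steps all of whose
visited sites are admissible the total discrepancy is at most `#diag · δ η₁ + #nn · η₂`.
[cite: ChelkakHonglerIzyurovAnnals2015, §2.8, proof of Prop. 2.20] -/
theorem abs_log_ratio_sub_le_of_itinerary {δ η₁ η₂ : ℝ} {A : Set (Site 2)} {P : Site 2 → ℝ}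
    {ℓ : ℂ → ℝ} (hpos : ∀ u, 0 < P u)
    (hdiag : ∀ u ∈ A, ∀ s ∈ diagSteps,
      |Real.log (P (u + s) / P u) - (ℓ (meshPoint δ (u + s)) - ℓ (meshPoint δ u))| ≤ δ * η₁)
    (hnn : ∀ u ∈ A, ∀ s ∈ nnSteps,
      |Real.log (P (u + s) / P u) - (ℓ (meshPoint δ (u + s)) - ℓ (meshPoint δ u))| ≤ η₂) :
    ∀ (L : List (Site 2)) (a : Site 2), (∀ s ∈ L, s ∈ diagSteps ∨ s ∈ nnSteps) → (∀ u ∈ visits a L, u ∈ A) →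
      |Real.log (P (a + L.sum) / P a) - (ℓ (meshPoint δ (a + L.sum)) - ℓ (meshPoint δ a))| ≤
        (L.countP fun s => s ∈ diagSteps) * (δ * η₁) + (L.countP fun s => s ∈ nnSteps) * η₂ := by
  intro L
  induction L with
  | nil =>
    intro a _ _
    simp [div_self (hpos a).ne']
  | cons s L ih =>
    intro a hsteps hvis
    have haA : a ∈ A := hvis a (by simp [visits])
    have hvis' : ∀ u ∈ visits (a + s) L, u ∈ A := fun u hu => hvis u (by simp [visits, hu])
    have hsteps' : ∀ s' ∈ L, s' ∈ diagSteps ∨ s' ∈ nnSteps := fun s' hs' => hsteps s' (by simp [hs'])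
    have ih' := ih (a + s) hsteps' hvis'
    have hsum : a + (s :: L).sum = (a + s) + L.sum := by rw [List.sum_cons, add_assoc]
    rw [hsum]
    -- telescoping of the logarithm and of `ℓ`
    have hlog : Real.log (P (a + s + L.sum) / P a) =
        Real.log (P (a + s + L.sum) / P (a + s)) + Real.log (P (a + s) / P a) := by
      rw [← Real.log_mul (div_pos (hpos _) (hpos _)).ne' (div_pos (hpos _) (hpos _)).ne']
      congr 1
      field_simp [(hpos (a + s)).ne', (hpos a).ne']
    have hstep : |Real.log (P (a + s) / P a) - (ℓ (meshPoint δ (a + s)) - ℓ (meshPoint δ a))| ≤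
        (if s ∈ diagSteps then 1 else 0) * (δ * η₁) + (if s ∈ nnSteps then 1 else 0) * η₂ := by
      rcases hsteps s (by simp) with hs | hs
      · have h := hdiag a haA s hs
        rw [if_pos hs]
        have h0 : 0 ≤ (if s ∈ nnSteps then 1 else 0 : ℝ) * η₂ := by
          split_ifs with h'
          · have := hnn a haA s h'; have := abs_nonneg (Real.log (P (a + s) / P a) - (ℓ (meshPoint δ (a + s)) - ℓ (meshPoint δ a))); linarith
          · simp
        linarith
      · have h := hnn a haA s hs
        rw [if_pos hs]
        have h0 : 0 ≤ (if s ∈ diagSteps then 1 else 0 : ℝ) * (δ * η₁) := by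
          split_ifs with h'
          · have := hdiag a haA s h'; have := abs_nonneg (Real.log (P (a + s) / P a) - (ℓ (meshPoint δ (a + s)) - ℓ (meshPoint δ a))); linarith
          · simp
        linarith
    rw [hlog, List.countP_cons, List.countP_cons]
    push_cast
    calc |Real.log (P (a + s + L.sum) / P (a + s)) + Real.log (P (a + s) / P a) -
          (ℓ (meshPoint δ (a + s + L.sum)) - ℓ (meshPoint δ a))|
        = |(Real.log (P (a + s + L.sum) / P (a + s)) - (ℓ (meshPoint δ (a + s + L.sum)) - ℓ (meshPoint δ (a + s)))) +
            (Real.log (P (a + s) / P a) - (ℓ (meshPoint δ (a + s)) - ℓ (meshPoint δ a)))| := by ring_nf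
      _ ≤ |Real.log (P (a + s + L.sum) / P (a + s)) - (ℓ (meshPoint δ (a + s + L.sum)) - ℓ (meshPoint δ (a + s)))| +
            |Real.log (P (a + s) / P a) - (ℓ (meshPoint δ (a + s)) - ℓ (meshPoint δ a))| := abs_add_le _ _
      _ ≤ ((L.countP fun s => s ∈ diagSteps) * (δ * η₁) + (L.countP fun s => s ∈ nnSteps) * η₂) +
            ((if s ∈ diagSteps then 1 else 0) * (δ * η₁) + (if s ∈ nnSteps then 1 else 0) * η₂) :=
          add_le_add ih' hstep
      _ = _ := by
          simp only [decide_eq_true_eq]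
          split_ifs <;> ring

/-! ### Mesh points of steps -/

/-- `meshPoint` is additive. [folklore] -/
theorem meshPoint_add_eq (δ : ℝ) (x y : Site 2) : meshPoint δ (x + y) = meshPoint δ x + meshPoint δ y := by
  apply Complex.ext <;> simp [mul_add]

/-- The mesh displacement of a step: `meshPoint δ s = δ · s`. [folklore] -/
theorem meshPoint_eq_smul (δ : ℝ) (s : Site 2) : meshPoint δ s = (δ : ℂ) * Site.toComplex s := rfl

/-- Coordinates of diagonal steps are `±1`. [folklore] -/
theorem coords_of_mem_diagSteps : ∀ s ∈ diagSteps, (s 0 = 1 ∨ s 0 = -1) ∧ (s 1 = 1 ∨ s 1 = -1) := by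
  decide

/-- Coordinates of nearest-neighbour steps: one is `±1`, the other `0`. [folklore] -/
theorem coords_of_mem_nnSteps : ∀ s ∈ nnSteps,
    ((s 0 = 1 ∨ s 0 = -1) ∧ s 1 = 0) ∨ (s 0 = 0 ∧ (s 1 = 1 ∨ s 1 = -1)) := by
  decide

/-- Diagonal steps have length `√2`. [folklore] -/
theorem norm_toComplex_of_mem_diagSteps {s : Site 2} (hs : s ∈ diagSteps) : ‖Site.toComplex s‖ = Real.sqrt 2 := by
  obtain ⟨h0, h1⟩ := coords_of_mem_diagSteps s hs
  have hsq : ‖Site.toComplex s‖ ^ 2 = 2 := by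
    rw [Complex.sq_norm, Complex.normSq_apply, Site.toComplex_re, Site.toComplex_im]
    rcases h0 with h0 | h0 <;> rcases h1 with h1 | h1 <;> simp [h0, h1] <;> norm_num
  rw [← Real.sqrt_sq (norm_nonneg _), hsq]

/-- Nearest-neighbour steps have length `1`. [folklore] -/
theorem norm_toComplex_of_mem_nnSteps {s : Site 2} (hs : s ∈ nnSteps) : ‖Site.toComplex s‖ = 1 := by
  have hsq : ‖Site.toComplex s‖ ^ 2 = 1 := by
    rw [Complex.sq_norm, Complex.normSq_apply, Site.toComplex_re, Site.toComplex_im]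
    rcases coords_of_mem_nnSteps s hs with ⟨h0 | h0, h1⟩ | ⟨h0, h1 | h1⟩ <;> simp [h0, h1]
  have h := Real.sqrt_sq (norm_nonneg (Site.toComplex s))
  rw [hsq, Real.sqrt_one] at h
  exact h.symm

/-- Diagonal and nearest-neighbour steps are different. [folklore] -/
theorem not_mem_nnSteps_of_mem_diagSteps {s : Site 2} (hs : s ∈ diagSteps) : s ∉ nnSteps := by
  intro h
  have h1 := norm_toComplex_of_mem_diagSteps hs
  rw [norm_toComplex_of_mem_nnSteps h] at h1
  have : Real.sqrt 2 = 1 := h1.symm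
  have h2 : Real.sqrt 2 ^ 2 = 2 := Real.sq_sqrt (by norm_num)
  rw [this] at h2
  norm_num at h2

/-! ### The per-step estimates -/

/-- **Diagonal step.** At a site whose mesh point `p` lies in `K`, if the discrete logarithmic
derivative is `ε₁`-close to `Dℓ(p)[s]`, `‖Dℓ‖ ≤ B` and `Dℓ` oscillates by at most `ω` on the
`δ√2`-ball about `p` inside `U`, then
`|log (P(v+s)/P v) - (ℓ(p + δs) - ℓ p)| ≤ δ (2δ(B√2 + ε₁)² + ε₁ + √2 ω)`.
[cite: ChelkakHonglerIzyurovAnnals2015, §2.8, proof of Prop. 2.20] -/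
theorem diag_step_estimate {U : Set ℂ} {ℓ : ℂ → ℝ} (hℓd : ∀ z ∈ U, DifferentiableAt ℝ ℓ z)
    {δ ε₁ B ω : ℝ} (hδ : 0 < δ) (hsmall : δ * (B * Real.sqrt 2 + ε₁) ≤ 1 / 2)
    {p : ℂ} (hball : closedBall p (δ * Real.sqrt 2) ⊆ U)
    (hBp : ‖fderiv ℝ ℓ p‖ ≤ B) (hωp : ∀ z ∈ closedBall p (δ * Real.sqrt 2), ‖fderiv ℝ ℓ z - fderiv ℝ ℓ p‖ ≤ ω)
    {s : Site 2} (hs : s ∈ diagSteps) {R : ℝ}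
    (hq : |(R - 1) / δ - fderiv ℝ ℓ p (Site.toComplex s)| < ε₁) :
    |Real.log R - (ℓ (p + (δ : ℂ) * Site.toComplex s) - ℓ p)| ≤
      δ * (2 * δ * (B * Real.sqrt 2 + ε₁) ^ 2 + ε₁ + Real.sqrt 2 * ω) := by
  set w : ℂ := Site.toComplex s with hw
  have hwn : ‖w‖ = Real.sqrt 2 := norm_toComplex_of_mem_diagSteps hs
  set q : ℝ := (R - 1) / δ with hqdef
  have hRq : R = 1 + δ * q := by rw [hqdef]; field_simp; ring
  -- bound on `q`
  have hD : |fderiv ℝ ℓ p w| ≤ B * Real.sqrt 2 := by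
    calc |fderiv ℝ ℓ p w| = ‖fderiv ℝ ℓ p w‖ := (Real.norm_eq_abs _).symm
      _ ≤ ‖fderiv ℝ ℓ p‖ * ‖w‖ := ContinuousLinearMap.le_opNorm _ _
      _ ≤ B * Real.sqrt 2 := by rw [hwn]; exact mul_le_mul_of_nonneg_right hBp (Real.sqrt_nonneg _)
  have hqb : |q| ≤ B * Real.sqrt 2 + ε₁ := by
    have := abs_sub_abs_le_abs_sub q (fderiv ℝ ℓ p w)
    linarith [hq.le]
  have hu : |δ * q| ≤ 1 / 2 := by
    rw [abs_mul, abs_of_pos hδ]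
    calc δ * |q| ≤ δ * (B * Real.sqrt 2 + ε₁) := mul_le_mul_of_nonneg_left hqb hδ.le
      _ ≤ 1 / 2 := hsmall
  -- (1) the logarithm
  have h1 : |Real.log R - δ * q| ≤ 2 * δ ^ 2 * (B * Real.sqrt 2 + ε₁) ^ 2 := by
    rw [hRq]
    refine (abs_log_one_add_sub_le hu).trans ?_
    rw [mul_pow]
    have : q ^ 2 ≤ (B * Real.sqrt 2 + ε₁) ^ 2 := by
      rw [← sq_abs q]
      exact pow_le_pow_left₀ (abs_nonneg q) hqb 2
    nlinarith [sq_nonneg δ]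
  -- (2) the linear term
  have h2 : |δ * q - δ * fderiv ℝ ℓ p w| ≤ δ * ε₁ := by
    rw [← mul_sub, abs_mul, abs_of_pos hδ]
    exact mul_le_mul_of_nonneg_left hq.le hδ.le
  -- (3) the mean value inequality for `ℓ`
  have h3 : |ℓ (p + (δ : ℂ) * w) - ℓ p - δ * fderiv ℝ ℓ p w| ≤ δ * (Real.sqrt 2 * ω) := by
    have hconv : Convex ℝ (closedBall p (δ * Real.sqrt 2)) := convex_closedBall _ _
    have hmem : p + (δ : ℂ) * w ∈ closedBall p (δ * Real.sqrt 2) := by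
      rw [mem_closedBall, dist_eq_norm, add_sub_cancel_left, norm_mul, Complex.norm_real, Real.norm_eq_abs,
        abs_of_pos hδ, hwn]
    have hdiff : ∀ z ∈ closedBall p (δ * Real.sqrt 2), DifferentiableAt ℝ ℓ z := fun z hz => hℓd z (hball hz)
    have key := hconv.norm_image_sub_le_of_norm_fderiv_le' hdiff hωp (mem_closedBall_self (by positivity)) hmem
    rw [add_sub_cancel_left, Real.norm_eq_abs] at key
    have hlin : fderiv ℝ ℓ p ((δ : ℂ) * w) = δ * fderiv ℝ ℓ p w := by
      rw [show (δ : ℂ) * w = (δ : ℝ) • w from (Complex.real_smul).symm, ContinuousLinearMap.map_smul, smul_eq_mul]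
    rw [hlin, norm_mul, Complex.norm_real, Real.norm_eq_abs, abs_of_pos hδ, hwn] at key
    calc |ℓ (p + (δ : ℂ) * w) - ℓ p - δ * fderiv ℝ ℓ p w| ≤ ω * (δ * Real.sqrt 2) := key
      _ = δ * (Real.sqrt 2 * ω) := by ring
  -- combine
  have htri : |Real.log R - (ℓ (p + (δ : ℂ) * w) - ℓ p)| ≤
      |Real.log R - δ * q| + |δ * q - δ * fderiv ℝ ℓ p w| + |ℓ (p + (δ : ℂ) * w) - ℓ p - δ * fderiv ℝ ℓ p w| := by
    have e : Real.log R - (ℓ (p + (δ : ℂ) * w) - ℓ p) =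
        (Real.log R - δ * q) + (δ * q - δ * fderiv ℝ ℓ p w) - (ℓ (p + (δ : ℂ) * w) - ℓ p - δ * fderiv ℝ ℓ p w) := by ring
    rw [e]
    exact (abs_sub _ _).trans (by linarith [abs_add_le (Real.log R - δ * q) (δ * q - δ * fderiv ℝ ℓ p w)])
  calc |Real.log R - (ℓ (p + (δ : ℂ) * w) - ℓ p)|
      ≤ 2 * δ ^ 2 * (B * Real.sqrt 2 + ε₁) ^ 2 + δ * ε₁ + δ * (Real.sqrt 2 * ω) := by linarith
    _ = δ * (2 * δ * (B * Real.sqrt 2 + ε₁) ^ 2 + ε₁ + Real.sqrt 2 * ω) := by ring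

/-- **Nearest-neighbour step.** If the ratio is `ε₂`-close to `1` (`ε₂ ≤ 1/2`) and `‖Dℓ‖ ≤ B` on the
`δ`-ball about `p` inside `U`, then `|log (P(v+e)/P v) - (ℓ(p + δe) - ℓ p)| ≤ 2ε₂ + Bδ`.
[cite: ChelkakHonglerIzyurovAnnals2015, Remark 2.18 and §2.8] -/
theorem nn_step_estimate {U : Set ℂ} {ℓ : ℂ → ℝ} (hℓd : ∀ z ∈ U, DifferentiableAt ℝ ℓ z)
    {δ ε₂ B : ℝ} (hδ : 0 < δ) (hε₂ : ε₂ ≤ 1 / 2)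
    {p : ℂ} (hball : closedBall p δ ⊆ U) (hBz : ∀ z ∈ closedBall p δ, ‖fderiv ℝ ℓ z‖ ≤ B)
    {s : Site 2} (hs : s ∈ nnSteps) {R : ℝ} (hq : |R - 1| < ε₂) :
    |Real.log R - (ℓ (p + (δ : ℂ) * Site.toComplex s) - ℓ p)| ≤ 2 * ε₂ + B * δ := by
  set w : ℂ := Site.toComplex s with hw
  have hwn : ‖w‖ = 1 := norm_toComplex_of_mem_nnSteps hs
  have h1 : |Real.log R| ≤ 2 * ε₂ := by
    have hu : |R - 1| ≤ 1 / 2 := hq.le.trans hε₂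
    have := abs_log_one_add_le hu
    rw [add_sub_cancel] at this
    linarith [hq.le]
  have h2 : |ℓ (p + (δ : ℂ) * w) - ℓ p| ≤ B * δ := by
    have hconv : Convex ℝ (closedBall p δ) := convex_closedBall _ _
    have hmem : p + (δ : ℂ) * w ∈ closedBall p δ := by
      rw [mem_closedBall, dist_eq_norm, add_sub_cancel_left, norm_mul, Complex.norm_real, Real.norm_eq_abs,
        abs_of_pos hδ, hwn, mul_one]
    have hdiff : ∀ z ∈ closedBall p δ, DifferentiableAt ℝ ℓ z := fun z hz => hℓd z (hball hz)
    have hB0 : ∀ z ∈ closedBall p δ, ‖fderiv ℝ ℓ z - 0‖ ≤ B := fun z hz => by rw [sub_zero]; exact hBz z hz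
    have key := hconv.norm_image_sub_le_of_norm_fderiv_le' hdiff hB0 (mem_closedBall_self hδ.le) hmem
    rw [show (0 : ℂ →L[ℝ] ℝ) ((p + (δ : ℂ) * w) - p) = 0 from rfl, sub_zero, add_sub_cancel_left, Real.norm_eq_abs, norm_mul,
      Complex.norm_real, Real.norm_eq_abs, abs_of_pos hδ, hwn, mul_one] at key
    exact key
  calc |Real.log R - (ℓ (p + (δ : ℂ) * w) - ℓ p)| ≤ |Real.log R| + |ℓ (p + (δ : ℂ) * w) - ℓ p| := abs_sub _ _
    _ ≤ 2 * ε₂ + B * δ := add_le_add h1 h2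

/-! ### The uniform estimate along admissible itineraries -/

/-- **Uniform smallness of the discrepancy along itineraries in a compact set.** Under `hdiag` and
`hnn` on the compact `K ⊆ U`, for every `ε > 0` and all small `δ`, every itinerary of diagonal and
nearest-neighbour steps visiting only sites with mesh point in `K`, with at most `Tmax/δ` diagonal
and `Mmax` nearest-neighbour steps, has `|log (P(end)/P(start)) - (ℓ(end) - ℓ(start))| ≤ ε`.
[cite: ChelkakHonglerIzyurovAnnals2015, §2.8, proof of Prop. 2.20] -/
theorem eventually_itinerary_estimate {U : Set ℂ} (hU : IsOpen U) {ℓ : ℂ → ℝ} (hℓ : ContDiffOn ℝ 1 ℓ U)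
    {K : Set ℂ} (hK : IsCompact K) (hKU : K ⊆ U) {P : ℝ → Site 2 → ℝ}
    (hpos : ∀ᶠ δ in 𝓝[>] (0 : ℝ), ∀ u, 0 < P δ u)
    (hdiag : ∀ s ∈ diagSteps, ∀ ε > (0 : ℝ), ∀ᶠ δ in 𝓝[>] (0 : ℝ), ∀ u : Site 2, meshPoint δ u ∈ K →
      |(P δ (u + s) / P δ u - 1) / δ - fderiv ℝ ℓ (meshPoint δ u) (Site.toComplex s)| < ε)
    (hnn : ∀ s ∈ nnSteps, ∀ ε > (0 : ℝ), ∀ᶠ δ in 𝓝[>] (0 : ℝ), ∀ u : Site 2, meshPoint δ u ∈ K →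
      |P δ (u + s) / P δ u - 1| < ε)
    {Tmax Mmax : ℝ} (hT : 0 ≤ Tmax) (hM : 0 ≤ Mmax) {ε : ℝ} (hε : 0 < ε) :
    ∀ᶠ δ in 𝓝[>] (0 : ℝ), ∀ (a : Site 2) (L : List (Site 2)),
      (∀ s ∈ L, s ∈ diagSteps ∨ s ∈ nnSteps) → (∀ u ∈ visits a L, meshPoint δ u ∈ K) →
      (L.countP fun s => s ∈ diagSteps) * δ ≤ Tmax → ((L.countP fun s => s ∈ nnSteps) : ℝ) ≤ Mmax →
      |Real.log (P δ (a + L.sum) / P δ a) - (ℓ (meshPoint δ (a + L.sum)) - ℓ (meshPoint δ a))| ≤ ε := by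
  -- a compact neighbourhood of `K` in `U`, bounds and uniform continuity of `Dℓ` there
  obtain ⟨r, hr, hK'U⟩ := hK.exists_cthickening_subset_open hU hKU
  set K' := cthickening r K with hK'def
  have hK' : IsCompact K' := hK.cthickening
  have hKK' : K ⊆ K' := self_subset_cthickening K
  have hℓd : ∀ z ∈ U, DifferentiableAt ℝ ℓ z := fun z hz =>
    (hℓ.differentiableOn one_ne_zero).differentiableAt (hU.mem_nhds hz)
  have hDcont : ContinuousOn (fderiv ℝ ℓ) U := hℓ.continuousOn_fderiv_of_isOpen hU le_rfl
  obtain ⟨B₀, hB₀⟩ := hK'.exists_bound_of_continuousOn (hDcont.mono hK'U)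
  set B := max B₀ 0 with hBdef
  have hB0 : 0 ≤ B := le_max_right _ _
  have hB : ∀ z ∈ K', ‖fderiv ℝ ℓ z‖ ≤ B := fun z hz => (hB₀ z hz).trans (le_max_left _ _)
  have huc : UniformContinuousOn (fderiv ℝ ℓ) K' := hK'.uniformContinuousOn_of_continuous (hDcont.mono hK'U)
  -- the small parameters
  set ε₁ : ℝ := ε / (4 * (Tmax + 1)) with hε₁def
  set ω : ℝ := ε / (8 * (Tmax + 1)) with hωdef
  set ε₂ : ℝ := min (1 / 4) (ε / (8 * (Mmax + 1))) with hε₂def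
  have hε₁0 : 0 < ε₁ := by positivity
  have hω0 : 0 < ω := by positivity
  have hε₂0 : 0 < ε₂ := lt_min (by norm_num) (by positivity)
  have hε₂h : ε₂ ≤ 1 / 2 := (min_le_left _ _).trans (by norm_num)
  obtain ⟨ρ, hρ, hρω⟩ := Metric.uniformContinuousOn_iff.1 huc ω hω0
  -- eventualities
  have e_diag : ∀ᶠ δ in 𝓝[>] (0 : ℝ), ∀ s ∈ diagSteps, ∀ u : Site 2, meshPoint δ u ∈ K →
      |(P δ (u + s) / P δ u - 1) / δ - fderiv ℝ ℓ (meshPoint δ u) (Site.toComplex s)| < ε₁ :=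
    (Filter.eventually_all_finset diagSteps).2 fun s hs => hdiag s hs ε₁ hε₁0
  have e_nn : ∀ᶠ δ in 𝓝[>] (0 : ℝ), ∀ s ∈ nnSteps, ∀ u : Site 2, meshPoint δ u ∈ K →
      |P δ (u + s) / P δ u - 1| < ε₂ :=
    (Filter.eventually_all_finset nnSteps).2 fun s hs => hnn s hs ε₂ hε₂0
  have h0 : Tendsto (fun δ : ℝ => δ) (𝓝[>] (0 : ℝ)) (𝓝 0) := tendsto_nhdsWithin_of_tendsto_nhds tendsto_id
  have e1 : ∀ᶠ δ in 𝓝[>] (0 : ℝ), δ * Real.sqrt 2 < min r ρ := by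
    have h := h0.mul_const (Real.sqrt 2); rw [zero_mul] at h
    exact h.eventually_lt_const (lt_min hr hρ)
  have e2 : ∀ᶠ δ in 𝓝[>] (0 : ℝ), δ * (B * Real.sqrt 2 + ε₁) < 1 / 2 := by
    have h := h0.mul_const (B * Real.sqrt 2 + ε₁); rw [zero_mul] at h
    exact h.eventually_lt_const (by norm_num)
  have e3 : ∀ᶠ δ in 𝓝[>] (0 : ℝ), Tmax * (2 * δ * (B * Real.sqrt 2 + ε₁) ^ 2) < ε / 8 := by
    have h := h0.const_mul (Tmax * (2 * (B * Real.sqrt 2 + ε₁) ^ 2)); rw [mul_zero] at h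
    refine (h.eventually_lt_const (by positivity : (0 : ℝ) < ε / 8)).mono fun δ hδ => ?_
    calc Tmax * (2 * δ * (B * Real.sqrt 2 + ε₁) ^ 2) = Tmax * (2 * (B * Real.sqrt 2 + ε₁) ^ 2) * δ := by ring
      _ < ε / 8 := hδ
  have e4 : ∀ᶠ δ in 𝓝[>] (0 : ℝ), Mmax * (B * δ) < ε / 8 := by
    have h := h0.const_mul (Mmax * B); rw [mul_zero] at h
    refine (h.eventually_lt_const (by positivity : (0 : ℝ) < ε / 8)).mono fun δ hδ => ?_
    calc Mmax * (B * δ) = Mmax * B * δ := by ring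
      _ < ε / 8 := hδ
  filter_upwards [e_diag, e_nn, e1, e2, e3, e4, hpos, self_mem_nhdsWithin] with δ hd hn h1 h2 h3 h4 hposδ hδ0
  have hδ : (0 : ℝ) < δ := hδ0
  have hδr : δ * Real.sqrt 2 ≤ r := (h1.trans_le (min_le_left _ _)).le
  have hδρ : δ * Real.sqrt 2 < ρ := h1.trans_le (min_le_right _ _)
  have hδr' : δ ≤ r := by
    have : δ ≤ δ * Real.sqrt 2 := by
      have hs : (1 : ℝ) ≤ Real.sqrt 2 := by
        rw [show (1 : ℝ) = Real.sqrt 1 from Real.sqrt_one.symm]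
        exact Real.sqrt_le_sqrt (by norm_num)
      nlinarith
    exact this.trans hδr
  intro a L hsteps hvis hTL hML
  -- balls about mesh points of `K` stay in `K' ⊆ U`
  have hballK' : ∀ {p : ℂ}, p ∈ K → ∀ {t : ℝ}, t ≤ r → closedBall p t ⊆ K' := fun hp t ht =>
    (closedBall_subset_cthickening hp _).trans (cthickening_mono ht K)
  -- the per-step bounds
  set η₁ : ℝ := 2 * δ * (B * Real.sqrt 2 + ε₁) ^ 2 + ε₁ + Real.sqrt 2 * ω with hη₁
  set η₂ : ℝ := 2 * ε₂ + B * δ with hη₂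
  have hη₁0 : 0 ≤ η₁ := by positivity
  have hη₂0 : 0 ≤ η₂ := by positivity
  have hstep_diag : ∀ u ∈ {u : Site 2 | meshPoint δ u ∈ K}, ∀ s ∈ diagSteps,
      |Real.log (P δ (u + s) / P δ u) - (ℓ (meshPoint δ (u + s)) - ℓ (meshPoint δ u))| ≤ δ * η₁ := by
    intro u hu s hs
    have hp : meshPoint δ u ∈ K := hu
    rw [meshPoint_add_eq, meshPoint_eq_smul δ s]
    refine diag_step_estimate (U := U) hℓd hδ h2.le ((hballK' hp hδr).trans hK'U) (hB _ (hKK' hp))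
      (fun z hz => ?_) hs (hd s hs u hp)
    rw [← dist_eq_norm]
    refine (hρω z (hballK' hp hδr hz) (meshPoint δ u) (hKK' hp) ?_).le
    exact (mem_closedBall.1 hz).trans_lt hδρ
  have hstep_nn : ∀ u ∈ {u : Site 2 | meshPoint δ u ∈ K}, ∀ s ∈ nnSteps,
      |Real.log (P δ (u + s) / P δ u) - (ℓ (meshPoint δ (u + s)) - ℓ (meshPoint δ u))| ≤ η₂ := by
    intro u hu s hs
    have hp : meshPoint δ u ∈ K := hu
    rw [meshPoint_add_eq, meshPoint_eq_smul δ s]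
    exact nn_step_estimate (U := U) hℓd hδ hε₂h ((hballK' hp hδr').trans hK'U)
      (fun z hz => hB z (hballK' hp hδr' hz)) hs (hn s hs u hp)
  have key := abs_log_ratio_sub_le_of_itinerary hposδ hstep_diag hstep_nn L a hsteps hvis
  -- bookkeeping
  have hcount1 : ((L.countP fun s => s ∈ diagSteps) : ℝ) * (δ * η₁) ≤ Tmax * η₁ := by
    calc ((L.countP fun s => s ∈ diagSteps) : ℝ) * (δ * η₁) = ((L.countP fun s => s ∈ diagSteps) * δ) * η₁ := by ring
      _ ≤ Tmax * η₁ := mul_le_mul_of_nonneg_right hTL hη₁0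
  have hcount2 : ((L.countP fun s => s ∈ nnSteps) : ℝ) * η₂ ≤ Mmax * η₂ := mul_le_mul_of_nonneg_right hML hη₂0
  have k1 : Tmax * ε₁ ≤ ε / 4 := by
    rw [hε₁def, show Tmax * (ε / (4 * (Tmax + 1))) = (Tmax / (Tmax + 1)) * (ε / 4) by field_simp]
    exact mul_le_of_le_one_left (by positivity) ((div_le_one (by positivity)).2 (by linarith))
  have k2 : Tmax * (Real.sqrt 2 * ω) ≤ ε / 4 := by
    have hs2 : Real.sqrt 2 ≤ 2 := by
      rw [show (2 : ℝ) = Real.sqrt 4 by rw [show (4 : ℝ) = 2 ^ 2 by norm_num, Real.sqrt_sq (by norm_num)]]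
      exact Real.sqrt_le_sqrt (by norm_num)
    have : Tmax * ω ≤ ε / 8 := by
      rw [hωdef, show Tmax * (ε / (8 * (Tmax + 1))) = (Tmax / (Tmax + 1)) * (ε / 8) by field_simp]
      exact mul_le_of_le_one_left (by positivity) ((div_le_one (by positivity)).2 (by linarith))
    calc Tmax * (Real.sqrt 2 * ω) = Real.sqrt 2 * (Tmax * ω) := by ring
      _ ≤ 2 * (ε / 8) := mul_le_mul hs2 this (by positivity) (by norm_num)
      _ = ε / 4 := by ring
  have k3 : Mmax * (2 * ε₂) ≤ ε / 4 := by
    have : ε₂ ≤ ε / (8 * (Mmax + 1)) := min_le_right _ _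
    calc Mmax * (2 * ε₂) ≤ Mmax * (2 * (ε / (8 * (Mmax + 1)))) := by gcongr
      _ = (Mmax / (Mmax + 1)) * (ε / 4) := by field_simp; ring
      _ ≤ ε / 4 := mul_le_of_le_one_left (by positivity) ((div_le_one (by positivity)).2 (by linarith))
  calc |Real.log (P δ (a + L.sum) / P δ a) - (ℓ (meshPoint δ (a + L.sum)) - ℓ (meshPoint δ a))|
      ≤ (L.countP fun s => s ∈ diagSteps) * (δ * η₁) + (L.countP fun s => s ∈ nnSteps) * η₂ := key
    _ ≤ Tmax * η₁ + Mmax * η₂ := add_le_add hcount1 hcount2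
    _ = Tmax * (2 * δ * (B * Real.sqrt 2 + ε₁) ^ 2) + Tmax * ε₁ + Tmax * (Real.sqrt 2 * ω) +
          (Mmax * (2 * ε₂) + Mmax * (B * δ)) := by rw [hη₁, hη₂]; ring
    _ ≤ ε / 8 + ε / 4 + ε / 4 + (ε / 4 + ε / 8) := by linarith [h3.le, h4.le]
    _ = ε := by ring

/-! ### Building itineraries: signed runs, chords, staircases -/

/-- The run of `|n|` copies of the step `s` (of `-s` if `n < 0`). [folklore] -/
def zrep (n : ℤ) (s : Site 2) : List (Site 2) :=
  if 0 ≤ n then List.replicate n.toNat s else List.replicate (-n).toNat (-s)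

/-- The total displacement of a signed run. [folklore] -/
theorem zrep_sum (n : ℤ) (s : Site 2) : (zrep n s).sum = n • s := by
  unfold zrep
  split_ifs with h
  · rw [List.sum_replicate, ← natCast_zsmul, Int.toNat_of_nonneg h]
  · have h' : 0 ≤ -n := by omega
    rw [List.sum_replicate, smul_neg, ← natCast_zsmul, Int.toNat_of_nonneg h', neg_smul, neg_neg]

/-- The steps of a signed run are `s` or `-s`. [folklore] -/
theorem mem_zrep {n : ℤ} {s t : Site 2} (ht : t ∈ zrep n s) : t = s ∨ t = -s := by
  unfold zrep at ht
  split_ifs at ht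
  · exact Or.inl (List.eq_of_mem_replicate ht)
  · exact Or.inr (List.eq_of_mem_replicate ht)

/-- The length of a signed run. [folklore] -/
theorem length_zrep (n : ℤ) (s : Site 2) : ((zrep n s).length : ℝ) = |(n : ℝ)| := by
  unfold zrep
  split_ifs with h
  · rw [List.length_replicate]
    have h1 : ((n.toNat : ℤ) : ℝ) = (n : ℝ) := by exact_mod_cast Int.toNat_of_nonneg h
    rw [abs_of_nonneg (by exact_mod_cast h), ← h1]
    norm_cast
  · rw [List.length_replicate]
    have h : n < 0 := not_le.1 h
    have h1 : (((-n).toNat : ℤ) : ℝ) = -(n : ℝ) := by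
      have := Int.toNat_of_nonneg (show 0 ≤ -n by omega)
      exact_mod_cast this
    rw [abs_of_neg (by exact_mod_cast h), ← h1]
    norm_cast

/-- Sites visited by a signed run are `a + j s` with `|j| ≤ |n|`. [folklore] -/
theorem mem_visits_zrep {a s u : Site 2} {n : ℤ} (hu : u ∈ visits a (zrep n s)) :
    ∃ j : ℤ, |j| ≤ |n| ∧ u = a + j • s := by
  unfold zrep at hu
  split_ifs at hu with h
  · obtain ⟨j, hj, rfl⟩ := mem_visits_replicate hu
    refine ⟨j, ?_, by rw [natCast_zsmul]⟩
    rw [abs_of_nonneg h, Nat.abs_cast]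
    have := Int.toNat_of_nonneg h
    omega
  · obtain ⟨j, hj, rfl⟩ := mem_visits_replicate hu
    refine ⟨-j, ?_, by rw [neg_smul, natCast_zsmul, smul_neg]⟩
    have h : n < 0 := not_le.1 h
    rw [abs_neg, Nat.abs_cast, abs_of_neg h]
    have := Int.toNat_of_nonneg (show 0 ≤ -n by omega)
    omega

/-- The mesh displacement along a signed run is at most `|n| δ ‖s‖`. [folklore] -/
theorem norm_sub_le_of_mem_visits_zrep {δ : ℝ} (hδ : 0 ≤ δ) {a s u : Site 2} {n : ℤ}
    (hu : u ∈ visits a (zrep n s)) :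
    ‖meshPoint δ u - meshPoint δ a‖ ≤ |(n : ℝ)| * (δ * ‖Site.toComplex s‖) := by
  obtain ⟨j, hj, rfl⟩ := mem_visits_zrep hu
  rw [meshPoint_add_eq, add_sub_cancel_left, meshPoint_eq_smul]
  have : Site.toComplex (j • s) = (j : ℂ) * Site.toComplex s := by
    apply Complex.ext <;> simp [zsmul_eq_mul]
  rw [this, norm_mul, norm_mul, Complex.norm_real, Complex.norm_intCast, Real.norm_eq_abs, abs_of_nonneg hδ]
  have hj' : |(j : ℝ)| ≤ |(n : ℝ)| := by exact_mod_cast hj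
  calc δ * (|(j : ℝ)| * ‖Site.toComplex s‖) = |(j : ℝ)| * (δ * ‖Site.toComplex s‖) := by ring
    _ ≤ |(n : ℝ)| * (δ * ‖Site.toComplex s‖) := by gcongr

/-- The diagonal steps `(1, 1)` and `(1, -1)`. [folklore] -/
def sPlus : Site 2 := cornerUnit 0 + cornerUnit 1

/-- The diagonal step `(1, -1)`. [folklore] -/
def sMinus : Site 2 := cornerUnit 3 + cornerUnit 0

/-- `(1,1)` as a complex number. [folklore] -/
theorem toComplex_sPlus : Site.toComplex sPlus = 1 + Complex.I := by
  apply Complex.ext <;> simp [sPlus, cornerUnit]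

/-- `(1,-1)` as a complex number. [folklore] -/
theorem toComplex_sMinus : Site.toComplex sMinus = 1 - Complex.I := by
  apply Complex.ext <;> simp [sMinus, cornerUnit, sub_eq_add_neg]

/-- `±(1,1)`, `±(1,-1)` are diagonal steps. [folklore] -/
theorem sPlus_mem : sPlus ∈ diagSteps ∧ -sPlus ∈ diagSteps ∧ sMinus ∈ diagSteps ∧ -sMinus ∈ diagSteps := by
  decide

/-- `‖1 + i‖ = √2` (cf. `IsoradialGraphsProofs`; restated to keep the import closure small). [folklore] -/
theorem norm_one_add_I_eq_sqrt_two : ‖(1 : ℂ) + Complex.I‖ = Real.sqrt 2 := by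
  rw [← toComplex_sPlus]; exact norm_toComplex_of_mem_diagSteps sPlus_mem.1

/-- `‖1 - i‖ = √2` (cf. `IsoradialGraphsProofs`; restated to keep the import closure small). [folklore] -/
theorem norm_one_sub_I_eq_sqrt_two : ‖(1 : ℂ) - Complex.I‖ = Real.sqrt 2 := by
  rw [← toComplex_sMinus]; exact norm_toComplex_of_mem_diagSteps sPlus_mem.2.2.1

/-- **The itinerary of a chord**: `Δ = α(1+i) + β(1-i)` is realised by `round(α/δ)` steps `±(1,1)`
followed by `round(β/δ)` steps `±(1,-1)`. [cite: ChelkakHonglerIzyurovAnnals2015, §2.8 ("one can move the points along horizontal and vertical segments")] -/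
def chordItin (δ : ℝ) (Δ : ℂ) : List (Site 2) :=
  zrep (round ((Δ.re + Δ.im) / 2 / δ)) sPlus ++ zrep (round ((Δ.re - Δ.im) / 2 / δ)) sMinus

/-- The steps of a chord itinerary are diagonal. [folklore] -/
theorem mem_diagSteps_of_mem_chordItin {δ : ℝ} {Δ : ℂ} {t : Site 2} (ht : t ∈ chordItin δ Δ) : t ∈ diagSteps := by
  rw [chordItin, List.mem_append] at ht
  rcases ht with ht | ht <;> rcases mem_zrep ht with rfl | rfl
  · exact sPlus_mem.1
  · exact sPlus_mem.2.1
  · exact sPlus_mem.2.2.1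
  · exact sPlus_mem.2.2.2

/-- Rounding error: `|δ round(x/δ) - x| ≤ δ/2`. [folklore] -/
theorem abs_mul_round_sub_le {δ : ℝ} (hδ : 0 < δ) (x : ℝ) : |δ * round (x / δ) - x| ≤ δ / 2 := by
  have h := abs_sub_round (x / δ)
  have : δ * round (x / δ) - x = -(δ * (x / δ - round (x / δ))) := by field_simp; ring
  rw [this, abs_neg, abs_mul, abs_of_pos hδ]
  calc δ * |x / δ - round (x / δ)| ≤ δ * (1 / 2) := by gcongr
    _ = δ / 2 := by ring

/-- `|round x| ≤ |x| + 1/2`. [folklore] -/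
theorem abs_round_le (x : ℝ) : |(round x : ℝ)| ≤ |x| + 1 / 2 := by
  have h := abs_sub_round x
  have := abs_sub_abs_le_abs_sub (round x : ℝ) x
  rw [abs_sub_comm] at this
  linarith

/-- **A chord itinerary realises its chord up to `δ√2`.** [folklore] -/
theorem norm_meshPoint_chordItin_sum_sub_le {δ : ℝ} (hδ : 0 < δ) (Δ : ℂ) :
    ‖meshPoint δ (chordItin δ Δ).sum - Δ‖ ≤ δ * Real.sqrt 2 := by
  set α : ℝ := (Δ.re + Δ.im) / 2 with hα
  set β : ℝ := (Δ.re - Δ.im) / 2 with hβ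
  have hΔ : Δ = (α : ℂ) * (1 + Complex.I) + (β : ℂ) * (1 - Complex.I) := by
    apply Complex.ext <;> simp [hα, hβ] <;> ring
  rw [chordItin, List.sum_append, zrep_sum, zrep_sum, meshPoint_add_eq, meshPoint_eq_smul, meshPoint_eq_smul]
  have e1 : Site.toComplex (round (α / δ) • sPlus) = (round (α / δ) : ℂ) * (1 + Complex.I) := by
    rw [← toComplex_sPlus]; apply Complex.ext <;> simp [zsmul_eq_mul]
  have e2 : Site.toComplex (round (β / δ) • sMinus) = (round (β / δ) : ℂ) * (1 - Complex.I) := by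
    rw [← toComplex_sMinus]; apply Complex.ext <;> simp [zsmul_eq_mul]
  rw [e1, e2]
  have : (δ : ℂ) * ((round (α / δ) : ℂ) * (1 + Complex.I)) + (δ : ℂ) * ((round (β / δ) : ℂ) * (1 - Complex.I)) - Δ =
      ((δ * round (α / δ) - α : ℝ) : ℂ) * (1 + Complex.I) + ((δ * round (β / δ) - β : ℝ) : ℂ) * (1 - Complex.I) := by
    rw [hΔ]; push_cast; ring
  rw [this]
  calc ‖((δ * round (α / δ) - α : ℝ) : ℂ) * (1 + Complex.I) + ((δ * round (β / δ) - β : ℝ) : ℂ) * (1 - Complex.I)‖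
      ≤ ‖((δ * round (α / δ) - α : ℝ) : ℂ) * (1 + Complex.I)‖ + ‖((δ * round (β / δ) - β : ℝ) : ℂ) * (1 - Complex.I)‖ :=
        norm_add_le _ _
    _ = |δ * round (α / δ) - α| * Real.sqrt 2 + |δ * round (β / δ) - β| * Real.sqrt 2 := by
        rw [norm_mul, norm_mul, Complex.norm_real, Complex.norm_real, Real.norm_eq_abs, Real.norm_eq_abs,
          norm_one_add_I_eq_sqrt_two, norm_one_sub_I_eq_sqrt_two]
    _ ≤ δ / 2 * Real.sqrt 2 + δ / 2 * Real.sqrt 2 := by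
        gcongr
        · exact abs_mul_round_sub_le hδ α
        · exact abs_mul_round_sub_le hδ β
    _ = δ * Real.sqrt 2 := by ring

/-- `|α| + |β| ≤ 2‖Δ‖` for the diagonal coordinates of a chord. [folklore] -/
theorem abs_diag_coords_le (Δ : ℂ) : |(Δ.re + Δ.im) / 2| + |(Δ.re - Δ.im) / 2| ≤ 2 * ‖Δ‖ := by
  have h1 : |Δ.re| ≤ ‖Δ‖ := Complex.abs_re_le_norm Δ
  have h2 : |Δ.im| ≤ ‖Δ‖ := Complex.abs_im_le_norm Δ
  have h3 : |(Δ.re + Δ.im) / 2| ≤ (|Δ.re| + |Δ.im|) / 2 := by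
    rw [abs_div, abs_two]; gcongr; exact abs_add_le _ _
  have h4 : |(Δ.re - Δ.im) / 2| ≤ (|Δ.re| + |Δ.im|) / 2 := by
    rw [abs_div, abs_two]; gcongr; exact abs_sub _ _
  linarith

/-- A signed run of `round(x/δ)` steps of length `√2` covers at most `(|x| + δ/2)√2`. [folklore] -/
theorem abs_round_mul_le {δ : ℝ} (hδ : 0 < δ) (x : ℝ) :
    |(round (x / δ) : ℝ)| * (δ * Real.sqrt 2) ≤ (|x| + δ / 2) * Real.sqrt 2 := by
  have h := abs_round_le (x / δ)
  rw [abs_div, abs_of_pos hδ] at h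
  calc |(round (x / δ) : ℝ)| * (δ * Real.sqrt 2) = (|(round (x / δ) : ℝ)| * δ) * Real.sqrt 2 := by ring
    _ ≤ ((|x| / δ + 1 / 2) * δ) * Real.sqrt 2 := by gcongr
    _ = (|x| + δ / 2) * Real.sqrt 2 := by field_simp

/-- **Sites visited by a chord itinerary stay within `(2‖Δ‖ + δ)√2` of its start.** [folklore] -/
theorem norm_sub_le_of_mem_visits_chordItin {δ : ℝ} (hδ : 0 < δ) {Δ : ℂ} {a u : Site 2}
    (hu : u ∈ visits a (chordItin δ Δ)) : ‖meshPoint δ u - meshPoint δ a‖ ≤ (2 * ‖Δ‖ + δ) * Real.sqrt 2 := by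
  have hαβ := abs_diag_coords_le Δ
  have hs2 : 0 ≤ Real.sqrt 2 := Real.sqrt_nonneg _
  have hA := abs_round_mul_le hδ ((Δ.re + Δ.im) / 2)
  have hB := abs_round_mul_le hδ ((Δ.re - Δ.im) / 2)
  rcases visits_append a _ _ u hu with h | h
  · have h1 := norm_sub_le_of_mem_visits_zrep hδ.le h
    rw [norm_toComplex_of_mem_diagSteps sPlus_mem.1] at h1
    calc ‖meshPoint δ u - meshPoint δ a‖ ≤ (|(Δ.re + Δ.im) / 2| + δ / 2) * Real.sqrt 2 := h1.trans hA
      _ ≤ (2 * ‖Δ‖ + δ) * Real.sqrt 2 :=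
          mul_le_mul_of_nonneg_right (by linarith [abs_nonneg ((Δ.re - Δ.im) / 2)]) hs2
  · have h1 := norm_sub_le_of_mem_visits_zrep hδ.le h
    rw [norm_toComplex_of_mem_diagSteps sPlus_mem.2.2.1] at h1
    have h2 := norm_sub_le_of_mem_visits_zrep hδ.le (end_mem_visits a (zrep (round ((Δ.re + Δ.im) / 2 / δ)) sPlus))
    rw [norm_toComplex_of_mem_diagSteps sPlus_mem.1] at h2
    calc ‖meshPoint δ u - meshPoint δ a‖
        ≤ ‖meshPoint δ u - meshPoint δ (a + (zrep (round ((Δ.re + Δ.im) / 2 / δ)) sPlus).sum)‖ +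
            ‖meshPoint δ (a + (zrep (round ((Δ.re + Δ.im) / 2 / δ)) sPlus).sum) - meshPoint δ a‖ :=
          norm_sub_le_norm_sub_add_norm_sub _ _ _
      _ ≤ (|(Δ.re - Δ.im) / 2| + δ / 2) * Real.sqrt 2 + (|(Δ.re + Δ.im) / 2| + δ / 2) * Real.sqrt 2 :=
          add_le_add (h1.trans hB) (h2.trans hA)
      _ = ((|(Δ.re + Δ.im) / 2| + |(Δ.re - Δ.im) / 2|) + δ) * Real.sqrt 2 := by ring
      _ ≤ (2 * ‖Δ‖ + δ) * Real.sqrt 2 := mul_le_mul_of_nonneg_right (by linarith) hs2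

/-- The number of (diagonal) steps of a chord itinerary, times `δ`, is at most `2‖Δ‖ + δ`. [folklore] -/
theorem countP_chordItin_mul_le {δ : ℝ} (hδ : 0 < δ) (Δ : ℂ) :
    ((chordItin δ Δ).countP fun s => s ∈ diagSteps) * δ ≤ 2 * ‖Δ‖ + δ := by
  have hαβ := abs_diag_coords_le Δ
  rw [List.countP_eq_length.2 fun t ht => by simpa using mem_diagSteps_of_mem_chordItin ht, chordItin,
    List.length_append, Nat.cast_add, length_zrep, length_zrep]
  have hnα := abs_round_le ((Δ.re + Δ.im) / 2 / δ)
  have hnβ := abs_round_le ((Δ.re - Δ.im) / 2 / δ)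
  rw [abs_div _ δ, abs_of_pos hδ] at hnα hnβ
  calc (|(round ((Δ.re + Δ.im) / 2 / δ) : ℝ)| + |(round ((Δ.re - Δ.im) / 2 / δ) : ℝ)|) * δ
      ≤ ((|(Δ.re + Δ.im) / 2| / δ + 1 / 2) + (|(Δ.re - Δ.im) / 2| / δ + 1 / 2)) * δ := by gcongr
    _ = |(Δ.re + Δ.im) / 2| + |(Δ.re - Δ.im) / 2| + δ := by field_simp; ring
    _ ≤ 2 * ‖Δ‖ + δ := by linarith

/-- A chord itinerary has no nearest-neighbour steps. [folklore] -/
theorem countP_nn_chordItin (δ : ℝ) (Δ : ℂ) : ((chordItin δ Δ).countP fun s => s ∈ nnSteps) = 0 := by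
  rw [List.countP_eq_zero]
  intro t ht
  simpa using not_mem_nnSteps_of_mem_diagSteps (mem_diagSteps_of_mem_chordItin ht)

/-- **The itinerary through a list of anchors** `z → z₁ → z₂ → ⋯`: the concatenation of the chord
itineraries of the consecutive differences. [cite: ChelkakHonglerIzyurovAnnals2015, §2.8, proof of Prop. 2.20] -/
def chordsItin (δ : ℝ) : ℂ → List ℂ → List (Site 2)
  | _, [] => []
  | z, z' :: Zs => chordItin δ (z' - z) ++ chordsItin δ z' Zs

/-- Consecutive anchors are at distance at most `M`. [folklore] -/
def ChordBound (M : ℝ) : ℂ → List ℂ → Prop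
  | _, [] => True
  | z, z' :: Zs => ‖z' - z‖ ≤ M ∧ ChordBound M z' Zs

/-- Unfolding `chordsItin` on a nonempty anchor list. [folklore] -/
theorem chordsItin_cons (δ : ℝ) (z z' : ℂ) (Zs : List ℂ) :
    chordsItin δ z (z' :: Zs) = chordItin δ (z' - z) ++ chordsItin δ z' Zs := rfl

/-- `chordsItin` on the empty anchor list. [folklore] -/
theorem chordsItin_nil (δ : ℝ) (z : ℂ) : chordsItin δ z [] = [] := rfl

/-- Unfolding `ChordBound`. [folklore] -/
theorem chordBound_cons {M : ℝ} {z z' : ℂ} {Zs : List ℂ} : ChordBound M z (z' :: Zs) ↔ ‖z' - z‖ ≤ M ∧ ChordBound M z' Zs :=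
  Iff.rfl

/-- All steps through anchors are diagonal. [folklore] -/
theorem mem_diagSteps_of_mem_chordsItin {δ : ℝ} (Zs : List ℂ) :
    ∀ (z : ℂ), ∀ t ∈ chordsItin δ z Zs, t ∈ diagSteps := by
  induction Zs with
  | nil => intro z t ht; simp [chordsItin_nil] at ht
  | cons z' Zs ih =>
    intro z t ht
    rw [chordsItin_cons, List.mem_append] at ht
    rcases ht with ht | ht
    · exact mem_diagSteps_of_mem_chordItin ht
    · exact ih z' t ht

/-- No nearest-neighbour steps through anchors. [folklore] -/
theorem countP_nn_chordsItin (δ : ℝ) (z : ℂ) (Zs : List ℂ) : ((chordsItin δ z Zs).countP fun s => s ∈ nnSteps) = 0 := by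
  rw [List.countP_eq_zero]
  intro t ht
  simpa using not_mem_nnSteps_of_mem_diagSteps (mem_diagSteps_of_mem_chordsItin Zs z t ht)

/-- The number of diagonal steps through anchors, times `δ`, is at most `#anchors · (2M + δ)`. [folklore] -/
theorem countP_chordsItin_mul_le {δ : ℝ} (hδ : 0 < δ) {M : ℝ} (Zs : List ℂ) :
    ∀ (z : ℂ), ChordBound M z Zs →
      ((chordsItin δ z Zs).countP fun s => s ∈ diagSteps) * δ ≤ Zs.length * (2 * M + δ) := by
  induction Zs with
  | nil => intro z _; simp [chordsItin_nil]
  | cons z' Zs ih =>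
    intro z hb
    obtain ⟨h1, h2⟩ := chordBound_cons.1 hb
    rw [chordsItin_cons, List.countP_append, Nat.cast_add, add_mul, List.length_cons, Nat.cast_succ]
    have hc : ((chordItin δ (z' - z)).countP fun s => s ∈ diagSteps) * δ ≤ 2 * M + δ :=
      (countP_chordItin_mul_le hδ _).trans (by linarith)
    calc _ ≤ (2 * M + δ) + Zs.length * (2 * M + δ) := add_le_add hc (ih z' h2)
      _ = (Zs.length + 1) * (2 * M + δ) := by ring

/-- **The itinerary through anchors ends near the last anchor**: within `E + #anchors · δ√2` if it
starts within `E` of the first. [folklore] -/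
theorem norm_end_chordsItin_sub_le {δ : ℝ} (hδ : 0 < δ) (Zs : List ℂ) :
    ∀ (z : ℂ) (c : Site 2) (E : ℝ), ‖meshPoint δ c - z‖ ≤ E →
      ‖meshPoint δ (c + (chordsItin δ z Zs).sum) - Zs.getLastD z‖ ≤ E + Zs.length * (δ * Real.sqrt 2) := by
  induction Zs with
  | nil => intro z c E hc; simpa [chordsItin_nil] using hc
  | cons z' Zs ih =>
    intro z c E hc
    rw [chordsItin_cons, List.sum_append, ← add_assoc, List.getLastD_cons, List.length_cons, Nat.cast_succ]
    have hc' : ‖meshPoint δ (c + (chordItin δ (z' - z)).sum) - z'‖ ≤ E + δ * Real.sqrt 2 := by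
      rw [meshPoint_add_eq]
      have e : meshPoint δ c + meshPoint δ (chordItin δ (z' - z)).sum - z' =
          (meshPoint δ c - z) + (meshPoint δ (chordItin δ (z' - z)).sum - (z' - z)) := by ring
      rw [e]
      exact (norm_add_le _ _).trans (add_le_add hc (norm_meshPoint_chordItin_sum_sub_le hδ _))
    calc _ ≤ E + δ * Real.sqrt 2 + Zs.length * (δ * Real.sqrt 2) := ih z' _ _ hc'
      _ = E + (Zs.length + 1) * (δ * Real.sqrt 2) := by ring

/-- **Sites visited through anchors stay near the anchors**: within
`E + #anchors · δ√2 + (2M + δ)√2` of some anchor. [folklore] -/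
theorem exists_anchor_near_of_mem_visits_chordsItin {δ : ℝ} (hδ : 0 < δ) {M : ℝ} (hM : 0 ≤ M) (Zs : List ℂ) :
    ∀ (z : ℂ) (c : Site 2) (E : ℝ), ‖meshPoint δ c - z‖ ≤ E → ChordBound M z Zs →
      ∀ u ∈ visits c (chordsItin δ z Zs), ∃ w ∈ z :: Zs,
        ‖meshPoint δ u - w‖ ≤ E + Zs.length * (δ * Real.sqrt 2) + (2 * M + δ) * Real.sqrt 2 := by
  induction Zs with
  | nil =>
    intro z c E hc _ u hu
    simp only [chordsItin_nil, visits, List.mem_singleton] at hu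
    subst hu
    refine ⟨z, by simp, ?_⟩
    have : 0 ≤ (2 * M + δ) * Real.sqrt 2 := by positivity
    simpa using hc.trans (by linarith)
  | cons z' Zs ih =>
    intro z c E hc hb u hu
    obtain ⟨h1, h2⟩ := chordBound_cons.1 hb
    have hs2 : 0 ≤ Real.sqrt 2 := Real.sqrt_nonneg _
    rw [chordsItin_cons] at hu
    rcases visits_append c _ _ u hu with hu | hu
    · refine ⟨z, by simp, ?_⟩
      have hu' := norm_sub_le_of_mem_visits_chordItin hδ hu
      have hlen : 0 ≤ ((z' :: Zs).length : ℝ) * (δ * Real.sqrt 2) := by positivity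
      calc ‖meshPoint δ u - z‖ ≤ ‖meshPoint δ u - meshPoint δ c‖ + ‖meshPoint δ c - z‖ := norm_sub_le_norm_sub_add_norm_sub _ _ _
        _ ≤ (2 * ‖z' - z‖ + δ) * Real.sqrt 2 + E := add_le_add hu' hc
        _ ≤ (2 * M + δ) * Real.sqrt 2 + E := by gcongr
        _ ≤ E + (z' :: Zs).length * (δ * Real.sqrt 2) + (2 * M + δ) * Real.sqrt 2 := by linarith
    · have hc' : ‖meshPoint δ (c + (chordItin δ (z' - z)).sum) - z'‖ ≤ E + δ * Real.sqrt 2 := by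
        rw [meshPoint_add_eq]
        have e : meshPoint δ c + meshPoint δ (chordItin δ (z' - z)).sum - z' =
            (meshPoint δ c - z) + (meshPoint δ (chordItin δ (z' - z)).sum - (z' - z)) := by ring
        rw [e]
        exact (norm_add_le _ _).trans (add_le_add hc (norm_meshPoint_chordItin_sum_sub_le hδ _))
      obtain ⟨w, hw, hwu⟩ := ih z' _ _ hc' h2 u hu
      refine ⟨w, List.mem_cons_of_mem _ hw, ?_⟩
      calc ‖meshPoint δ u - w‖ ≤ E + δ * Real.sqrt 2 + Zs.length * (δ * Real.sqrt 2) + (2 * M + δ) * Real.sqrt 2 := hwu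
        _ = E + (z' :: Zs).length * (δ * Real.sqrt 2) + (2 * M + δ) * Real.sqrt 2 := by
            rw [List.length_cons, Nat.cast_succ]; ring

/-! ### Staircases of nearest-neighbour steps -/

/-- The staircase from `e` to `t`: `|t₀ - e₀|` horizontal then `|t₁ - e₁|` vertical unit steps. [folklore] -/
def stair (e t : Site 2) : List (Site 2) := zrep (t 0 - e 0) (cornerUnit 0) ++ zrep (t 1 - e 1) (cornerUnit 1)

/-- The staircase ends at its target. [folklore] -/
theorem add_stair_sum (e t : Site 2) : e + (stair e t).sum = t := by
  rw [stair, List.sum_append, zrep_sum, zrep_sum]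
  ext i
  fin_cases i <;> simp [cornerUnit]

/-- The steps of a staircase are nearest-neighbour steps. [folklore] -/
theorem mem_nnSteps_of_mem_stair {e t s : Site 2} (hs : s ∈ stair e t) : s ∈ nnSteps := by
  have key : cornerUnit 0 ∈ nnSteps ∧ -cornerUnit 0 ∈ nnSteps ∧ cornerUnit 1 ∈ nnSteps ∧ -cornerUnit 1 ∈ nnSteps := by
    decide
  rw [stair, List.mem_append] at hs
  rcases hs with hs | hs <;> rcases mem_zrep hs with rfl | rfl
  · exact key.1
  · exact key.2.1
  · exact key.2.2.1
  · exact key.2.2.2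

/-- A staircase has no diagonal steps. [folklore] -/
theorem countP_diag_stair (e t : Site 2) : ((stair e t).countP fun s => s ∈ diagSteps) = 0 := by
  rw [List.countP_eq_zero]
  intro s hs h
  exact not_mem_nnSteps_of_mem_diagSteps (by simpa using h) (mem_nnSteps_of_mem_stair hs)

/-- The number of steps of a staircase. [folklore] -/
theorem countP_nn_stair (e t : Site 2) :
    (((stair e t).countP fun s => s ∈ nnSteps) : ℝ) = |((t 0 - e 0 : ℤ) : ℝ)| + |((t 1 - e 1 : ℤ) : ℝ)| := by
  rw [List.countP_eq_length.2 fun s hs => by simpa using mem_nnSteps_of_mem_stair hs, stair, List.length_append,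
    Nat.cast_add, length_zrep, length_zrep]

/-- Sites of a staircase stay within `(|t₀ - e₀| + |t₁ - e₁|) δ` of its start. [folklore] -/
theorem norm_sub_le_of_mem_visits_stair {δ : ℝ} (hδ : 0 ≤ δ) {e t u : Site 2} (hu : u ∈ visits e (stair e t)) :
    ‖meshPoint δ u - meshPoint δ e‖ ≤ (|((t 0 - e 0 : ℤ) : ℝ)| + |((t 1 - e 1 : ℤ) : ℝ)|) * δ := by
  have n0 : ‖Site.toComplex (cornerUnit 0)‖ = 1 := norm_toComplex_of_mem_nnSteps (by decide)
  have n1 : ‖Site.toComplex (cornerUnit 1)‖ = 1 := norm_toComplex_of_mem_nnSteps (by decide)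
  have hA : 0 ≤ |((t 0 - e 0 : ℤ) : ℝ)| * δ := by positivity
  have hB : 0 ≤ |((t 1 - e 1 : ℤ) : ℝ)| * δ := by positivity
  rw [stair] at hu
  rcases visits_append e _ _ u hu with hu | hu
  · have h := norm_sub_le_of_mem_visits_zrep hδ hu
    rw [n0, mul_one] at h
    push_cast at h hB ⊢
    linarith
  · have h := norm_sub_le_of_mem_visits_zrep hδ hu
    rw [n1, mul_one] at h
    have h2 := norm_sub_le_of_mem_visits_zrep hδ (end_mem_visits e (zrep (t 0 - e 0) (cornerUnit 0)))
    rw [n0, mul_one] at h2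
    push_cast at h h2 ⊢
    calc ‖meshPoint δ u - meshPoint δ e‖
        ≤ ‖meshPoint δ u - meshPoint δ (e + (zrep (t 0 - e 0) (cornerUnit 0)).sum)‖ +
            ‖meshPoint δ (e + (zrep (t 0 - e 0) (cornerUnit 0)).sum) - meshPoint δ e‖ := norm_sub_le_norm_sub_add_norm_sub _ _ _
      _ ≤ |((t 1 : ℝ) - e 1)| * δ + |((t 0 : ℝ) - e 0)| * δ := add_le_add h h2
      _ = (|((t 0 : ℝ) - e 0)| + |((t 1 : ℝ) - e 1)|) * δ := by ring

/-- Lattice coordinates are controlled by mesh distances: `|u_k - v_k| δ ≤ ‖δu - δv‖`. [folklore] -/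
theorem abs_coord_sub_mul_le (δ : ℝ) (hδ : 0 ≤ δ) (u v : Site 2) (k : Fin 2) :
    |((u k - v k : ℤ) : ℝ)| * δ ≤ ‖meshPoint δ u - meshPoint δ v‖ := by
  have e : meshPoint δ u - meshPoint δ v = (δ : ℂ) * Site.toComplex (u - v) := by
    have h := meshPoint_add_eq δ (u - v) v
    rw [sub_add_cancel] at h
    rw [h, add_sub_cancel_right, meshPoint_eq_smul]
  rw [e, norm_mul, Complex.norm_real, Real.norm_eq_abs, abs_of_nonneg hδ, mul_comm]
  refine mul_le_mul_of_nonneg_left ?_ hδ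
  fin_cases k
  · have := Complex.abs_re_le_norm (Site.toComplex (u - v))
    simpa using this
  · have := Complex.abs_im_le_norm (Site.toComplex (u - v))
    simpa using this

/-! ### Anchor lists along a path -/

/-- Consecutive bounds give `ChordBound` for the anchor list `f (k+1), …, f (k+m)` from `f k`. [folklore] -/
theorem chordBound_map_range' {M : ℝ} (f : ℕ → ℂ) (m : ℕ) :
    ∀ k : ℕ, (∀ i, k ≤ i → i < k + m → ‖f (i + 1) - f i‖ ≤ M) → ChordBound M (f k) ((List.range' (k + 1) m).map f) := by
  induction m with
  | zero => intro k _; simp [ChordBound]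
  | succ m ih =>
    intro k hk
    rw [List.range'_succ, List.map_cons, chordBound_cons]
    exact ⟨hk k le_rfl (by omega), ih (k + 1) fun i hi hi' => hk i (by omega) (by omega)⟩

/-- The last anchor. [folklore] -/
theorem getLastD_map_range' (f : ℕ → ℂ) (m : ℕ) : ∀ k : ℕ, ((List.range' (k + 1) m).map f).getLastD (f k) = f (k + m) := by
  induction m with
  | zero => intro k; simp
  | succ m ih =>
    intro k
    rw [List.range'_succ, List.map_cons, List.getLastD_cons, ih (k + 1), show k + 1 + m = k + (m + 1) by omega]

/-- Anchors are values of `f`. [folklore] -/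
theorem exists_eq_of_mem_anchors {f : ℕ → ℂ} {m k : ℕ} {w : ℂ} (hw : w ∈ f k :: (List.range' (k + 1) m).map f) :
    ∃ i, w = f i := by
  simp only [List.mem_cons, List.mem_map, List.mem_range'_1] at hw
  rcases hw with rfl | ⟨i, -, rfl⟩
  · exact ⟨k, rfl⟩
  · exact ⟨i, rfl⟩

/-! ### The main theorem -/

/-- **Ratios from discrete logarithmic derivatives** (CHI15, Thm 1.5 & Remark 2.18 ⇒ Prop 2.20, in
abstract form). Let `U ⊆ ℂ` be open and connected, `ℓ ∈ C¹(U)`, `P δ : ℤ² → ℝ₊`. If, uniformly over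
lattice sites with mesh point in any compact `K ⊆ U`, the discrete logarithmic derivatives of `P δ`
along the four diagonal steps converge to the corresponding derivatives of `ℓ` (`hdiag`) and the
nearest-neighbour ratios converge to `1` (`hnn`), then for `y', y₀ ∈ U` and marked points
`y(δ) → y₀`, `P δ [y(δ)/δ] / P δ [y'/δ] → exp (ℓ y₀ - ℓ y')`.
[cite: ChelkakHonglerIzyurovAnnals2015, Prop. 2.20 and its proof (§2.8), Thm. 1.5, Remark 2.18] -/
theorem tendsto_ratio_of_logDerivative {U : Set ℂ} (hUo : IsOpen U) (hUc : IsConnected U)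
    {ℓ : ℂ → ℝ} (hℓ : ContDiffOn ℝ 1 ℓ U) {P : ℝ → Site 2 → ℝ} (hpos : ∀ᶠ δ in 𝓝[>] (0 : ℝ), ∀ u, 0 < P δ u)
    (hdiag : ∀ K ⊆ U, IsCompact K → ∀ s ∈ diagSteps, ∀ ε > (0 : ℝ), ∀ᶠ δ in 𝓝[>] (0 : ℝ), ∀ u : Site 2,
      meshPoint δ u ∈ K → |(P δ (u + s) / P δ u - 1) / δ - fderiv ℝ ℓ (meshPoint δ u) (Site.toComplex s)| < ε)
    (hnn : ∀ K ⊆ U, IsCompact K → ∀ s ∈ nnSteps, ∀ ε > (0 : ℝ), ∀ᶠ δ in 𝓝[>] (0 : ℝ), ∀ u : Site 2,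
      meshPoint δ u ∈ K → |P δ (u + s) / P δ u - 1| < ε)
    {y' y₀ : ℂ} (hy' : y' ∈ U) (hy₀ : y₀ ∈ U) {y : ℝ → ℂ} (hy : Tendsto y (𝓝[>] 0) (𝓝 y₀)) :
    Tendsto (fun δ => P δ (nearestSite δ (y δ)) / P δ (nearestSite δ y')) (𝓝[>] 0)
      (𝓝 (Real.exp (ℓ y₀ - ℓ y'))) := by
  /- Step A: a path from `y'` to `y₀` in `U`, a compact thickening `K`, and anchors along the path. -/
  have hpc : IsPathConnected U := hUo.isConnected_iff_isPathConnected.1 hUc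
  obtain ⟨γ, hγ⟩ := hpc.joinedIn y' hy' y₀ hy₀
  have hKc : IsCompact (Set.range γ) := isCompact_range γ.continuous
  have hKU : Set.range γ ⊆ U := by rintro _ ⟨t, rfl⟩; exact hγ t
  obtain ⟨R, hR, hRU⟩ := hKc.exists_cthickening_subset_open hUo hKU
  set K := cthickening R (Set.range γ) with hKdef
  have hK : IsCompact K := hKc.cthickening
  obtain ⟨θ, hθ, hθγ⟩ := Metric.uniformContinuous_iff.1
    (CompactSpace.uniformContinuous_of_continuous γ.continuous) (R / 4) (by positivity)
  obtain ⟨n, hn⟩ := exists_nat_gt (1 / θ)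
  have hn0 : 0 < n := by
    have : (0 : ℝ) < n := lt_trans (by positivity) hn
    exact_mod_cast this
  have hnθ : 1 / (n : ℝ) < θ := by
    rw [div_lt_iff₀ (by exact_mod_cast hn0)]
    rw [div_lt_iff₀ hθ] at hn
    linarith
  set tOf : ℕ → unitInterval := fun i => Set.projIcc 0 1 zero_le_one ((i : ℝ) / n) with htOf
  set f : ℕ → ℂ := fun i => γ (tOf i) with hf
  have hf0 : f 0 = y' := by
    have : tOf 0 = 0 := Subtype.ext (by simp [htOf])
    simp only [hf, this, Path.source]
  have hfn : f n = y₀ := by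
    have : tOf n = 1 := Subtype.ext (by simp [htOf, div_self (show (n : ℝ) ≠ 0 by exact_mod_cast hn0.ne')])
    simp only [hf, this, Path.target]
  have hfmem : ∀ i, f i ∈ Set.range γ := fun i => ⟨tOf i, rfl⟩
  have hchord : ∀ i, i < n → ‖f (i + 1) - f i‖ ≤ R / 4 := by
    intro i hi
    rw [← dist_eq_norm]
    refine (hθγ ?_).le
    rw [Subtype.dist_eq, htOf]
    have h1 : ((i : ℝ) + 1) / n ∈ Icc (0 : ℝ) 1 := by
      refine ⟨by positivity, ?_⟩
      rw [div_le_one (by exact_mod_cast hn0)]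
      exact_mod_cast hi
    have h2 : (i : ℝ) / n ∈ Icc (0 : ℝ) 1 := by
      refine ⟨by positivity, ?_⟩
      rw [div_le_one (by exact_mod_cast hn0)]
      exact_mod_cast hi.le
    simp only [Nat.cast_succ]
    rw [Set.projIcc_of_mem _ h1, Set.projIcc_of_mem _ h2, Real.dist_eq]
    rw [show ((i : ℝ) + 1) / n - i / n = 1 / n by rw [← sub_div]; ring]
    rwa [abs_of_pos (by positivity)]
  set Zs : List ℂ := (List.range' 1 n).map f with hZs
  have hZb : ChordBound (R / 4) y' Zs := by
    rw [← hf0]; exact chordBound_map_range' f n 0 fun i _ hi => hchord i (by omega)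
  have hZlast : Zs.getLastD y' = y₀ := by rw [← hf0, hZs, getLastD_map_range' f n 0, zero_add, hfn]
  have hZlen : Zs.length = n := by simp [hZs]
  have hZmem : ∀ w ∈ y' :: Zs, w ∈ Set.range γ := by
    intro w hw
    rw [← hf0] at hw
    obtain ⟨i, rfl⟩ := exists_eq_of_mem_anchors hw
    exact hfmem i
  /- Step B: the itinerary at mesh `δ`. -/
  set aOf : ℝ → Site 2 := fun δ => nearestSite δ y' with haOf
  set tgt : ℝ → Site 2 := fun δ => nearestSite δ (y δ) with htgt
  set L₁ : ℝ → List (Site 2) := fun δ => chordsItin δ y' Zs with hL₁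
  set c₁ : ℝ → Site 2 := fun δ => aOf δ + (L₁ δ).sum with hc₁
  set L₂ : ℝ → List (Site 2) := fun δ => chordItin δ (y δ - y₀) with hL₂
  set c₂ : ℝ → Site 2 := fun δ => c₁ δ + (L₂ δ).sum with hc₂
  set L₃ : ℝ → List (Site 2) := fun δ => stair (c₂ δ) (tgt δ) with hL₃
  set L : ℝ → List (Site 2) := fun δ => L₁ δ ++ (L₂ δ ++ L₃ δ) with hL
  have hLsum : ∀ δ, aOf δ + (L δ).sum = tgt δ := by
    intro δ
    simp only [hL, List.sum_append, ← add_assoc]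
    exact add_stair_sum (c₂ δ) (tgt δ)
  have hLsteps : ∀ δ, ∀ s ∈ L δ, s ∈ diagSteps ∨ s ∈ nnSteps := by
    intro δ s hs
    simp only [hL, List.mem_append] at hs
    rcases hs with hs | hs | hs
    · exact Or.inl (mem_diagSteps_of_mem_chordsItin Zs y' s hs)
    · exact Or.inl (mem_diagSteps_of_mem_chordItin hs)
    · exact Or.inr (mem_nnSteps_of_mem_stair hs)
  -- constants
  set Tmax : ℝ := n * (R / 2 + 1) + (R / 4 + 1) with hTmax
  set Mmax : ℝ := 2 * (2 * n + 4) with hMmax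
  have hTmax0 : 0 ≤ Tmax := by positivity
  have hMmax0 : 0 ≤ Mmax := by positivity
  have hs2 : Real.sqrt 2 ≤ 3 / 2 := by
    rw [show (3 / 2 : ℝ) = Real.sqrt ((3 / 2) ^ 2) by rw [Real.sqrt_sq (by norm_num)]]
    exact Real.sqrt_le_sqrt (by norm_num)
  have hs2' : 0 ≤ Real.sqrt 2 := Real.sqrt_nonneg _
  /- Step C: geometric estimates for small `δ`. -/
  have geo : ∀ δ : ℝ, 0 < δ → δ ≤ 1 → δ * (6 * n + 12) ≤ R / 8 → ‖y δ - y₀‖ ≤ R / 8 →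
      (∀ u ∈ visits (aOf δ) (L δ), meshPoint δ u ∈ K) ∧
      ((L δ).countP fun s => s ∈ diagSteps) * δ ≤ Tmax ∧
      (((L δ).countP fun s => s ∈ nnSteps) : ℝ) ≤ Mmax := by
    intro δ hδ hδ1 hδn hyδ
    have hn1 : (1 : ℝ) ≤ n := by exact_mod_cast hn0
    have E0 : ‖meshPoint δ (aOf δ) - y'‖ ≤ δ := by
      rw [← dist_eq_norm]; exact dist_meshPoint_nearestSite_le hδ y'
    have E1 : ‖meshPoint δ (c₁ δ) - y₀‖ ≤ δ + n * (δ * Real.sqrt 2) := by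
      have h := norm_end_chordsItin_sub_le hδ Zs y' (aOf δ) δ E0
      rwa [hZlast, hZlen] at h
    have E2 : ‖meshPoint δ (c₂ δ) - y δ‖ ≤ δ + n * (δ * Real.sqrt 2) + δ * Real.sqrt 2 := by
      simp only [hc₂]
      rw [meshPoint_add_eq]
      have e : meshPoint δ (c₁ δ) + meshPoint δ (L₂ δ).sum - y δ =
          (meshPoint δ (c₁ δ) - y₀) + (meshPoint δ (L₂ δ).sum - (y δ - y₀)) := by ring
      rw [e]
      exact (norm_add_le _ _).trans (add_le_add E1 (norm_meshPoint_chordItin_sum_sub_le hδ _))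
    have E3 : ‖meshPoint δ (c₂ δ) - meshPoint δ (tgt δ)‖ ≤ δ * (2 * n + 4) := by
      have ht : ‖meshPoint δ (tgt δ) - y δ‖ ≤ δ := by
        rw [← dist_eq_norm]; exact dist_meshPoint_nearestSite_le hδ (y δ)
      have a1 : (n : ℝ) * (δ * Real.sqrt 2) ≤ n * (δ * (3 / 2)) := by gcongr
      have a2 : δ * Real.sqrt 2 ≤ δ * (3 / 2) := by gcongr
      have a3 : 0 ≤ (n : ℝ) * δ := by positivity
      calc ‖meshPoint δ (c₂ δ) - meshPoint δ (tgt δ)‖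
          ≤ ‖meshPoint δ (c₂ δ) - y δ‖ + ‖y δ - meshPoint δ (tgt δ)‖ := norm_sub_le_norm_sub_add_norm_sub _ _ _
        _ ≤ (δ + n * (δ * Real.sqrt 2) + δ * Real.sqrt 2) + δ := by rw [norm_sub_rev (y δ)]; exact add_le_add E2 ht
        _ ≤ δ * (2 * n + 4) := by nlinarith
    have hcoord : ∀ k : Fin 2, |((tgt δ k - c₂ δ k : ℤ) : ℝ)| ≤ 2 * n + 4 := by
      intro k
      have h : |((tgt δ k - c₂ δ k : ℤ) : ℝ)| * δ ≤ δ * (2 * n + 4) :=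
        (abs_coord_sub_mul_le δ hδ.le (tgt δ) (c₂ δ) k).trans (by rw [norm_sub_rev]; exact E3)
      nlinarith [abs_nonneg (((tgt δ k - c₂ δ k : ℤ)) : ℝ)]
    refine ⟨?_, ?_, ?_⟩
    · -- visited sites lie in `K`
      intro u hu
      simp only [hL] at hu
      rcases visits_append (aOf δ) _ _ u hu with hu | hu
      · -- along the anchors
        obtain ⟨w, hw, hwu⟩ := exists_anchor_near_of_mem_visits_chordsItin hδ (by positivity) Zs y' (aOf δ) δ E0 hZb u hu
        refine closedBall_subset_cthickening (hZmem w hw) R ?_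
        rw [mem_closedBall, dist_eq_norm]
        rw [hZlen] at hwu
        calc ‖meshPoint δ u - w‖ ≤ δ + n * (δ * Real.sqrt 2) + (2 * (R / 4) + δ) * Real.sqrt 2 := hwu
          _ ≤ R := by nlinarith
      · rcases visits_append (c₁ δ) _ _ u hu with hu | hu
        · -- the last chord
          have h1 := norm_sub_le_of_mem_visits_chordItin hδ hu
          refine closedBall_subset_cthickening (hZmem y₀ ?_) R ?_
          · rw [← hZlast]
            exact List.getLastD_mem_cons
          rw [mem_closedBall, dist_eq_norm]
          calc ‖meshPoint δ u - y₀‖ ≤ ‖meshPoint δ u - meshPoint δ (c₁ δ)‖ + ‖meshPoint δ (c₁ δ) - y₀‖ :=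
                norm_sub_le_norm_sub_add_norm_sub _ _ _
            _ ≤ (2 * ‖y δ - y₀‖ + δ) * Real.sqrt 2 + (δ + n * (δ * Real.sqrt 2)) := add_le_add h1 E1
            _ ≤ (2 * (R / 8) + δ) * Real.sqrt 2 + (δ + n * (δ * Real.sqrt 2)) := by gcongr
            _ ≤ R := by nlinarith
        · -- the staircase
          have h1 := norm_sub_le_of_mem_visits_stair hδ.le hu
          refine closedBall_subset_cthickening (hZmem y₀ ?_) R ?_
          · rw [← hZlast]
            exact List.getLastD_mem_cons
          rw [mem_closedBall, dist_eq_norm]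
          have h0 := hcoord 0
          have h1' := hcoord 1
          calc ‖meshPoint δ u - y₀‖ ≤ ‖meshPoint δ u - meshPoint δ (c₂ δ)‖ + (‖meshPoint δ (c₂ δ) - y δ‖ + ‖y δ - y₀‖) :=
                (norm_sub_le_norm_sub_add_norm_sub _ (meshPoint δ (c₂ δ)) _).trans
                  (add_le_add le_rfl (norm_sub_le_norm_sub_add_norm_sub _ _ _))
            _ ≤ (|((tgt δ 0 - c₂ δ 0 : ℤ) : ℝ)| + |((tgt δ 1 - c₂ δ 1 : ℤ) : ℝ)|) * δ +
                  ((δ + n * (δ * Real.sqrt 2) + δ * Real.sqrt 2) + R / 8) := add_le_add h1 (add_le_add E2 hyδ)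
            _ ≤ ((2 * n + 4) + (2 * n + 4)) * δ + ((δ + n * (δ * Real.sqrt 2) + δ * Real.sqrt 2) + R / 8) := by gcongr
            _ ≤ R := by nlinarith
    · -- diagonal count
      have h3 : ((L₃ δ).countP fun s => s ∈ diagSteps) = 0 := countP_diag_stair _ _
      have hsplit : (((L δ).countP fun s => s ∈ diagSteps) : ℝ) * δ =
          ((L₁ δ).countP fun s => s ∈ diagSteps) * δ + ((L₂ δ).countP fun s => s ∈ diagSteps) * δ := by
        simp only [hL, List.countP_append, h3, add_zero, Nat.cast_add, add_mul]
      rw [hsplit]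
      have h1 := countP_chordsItin_mul_le hδ Zs y' hZb
      rw [hZlen] at h1
      have h2 := countP_chordItin_mul_le hδ (y δ - y₀)
      calc ((L₁ δ).countP fun s => s ∈ diagSteps) * δ + ((L₂ δ).countP fun s => s ∈ diagSteps) * δ
          ≤ n * (2 * (R / 4) + δ) + (2 * ‖y δ - y₀‖ + δ) := add_le_add h1 h2
        _ ≤ n * (2 * (R / 4) + 1) + (2 * (R / 8) + 1) := by gcongr
        _ = Tmax := by simp only [hTmax]; ring
    · -- nearest-neighbour count
      have h1 : ((L₁ δ).countP fun s => s ∈ nnSteps) = 0 := countP_nn_chordsItin _ _ _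
      have h2 : ((L₂ δ).countP fun s => s ∈ nnSteps) = 0 := countP_nn_chordItin _ _
      have hsplit : (((L δ).countP fun s => s ∈ nnSteps) : ℝ) = ((L₃ δ).countP fun s => s ∈ nnSteps) := by
        simp only [hL, List.countP_append, h1, h2, zero_add]
      rw [hsplit]
      show (((stair (c₂ δ) (tgt δ)).countP fun s => s ∈ nnSteps) : ℝ) ≤ Mmax
      rw [countP_nn_stair]
      have h0 := hcoord 0
      have h1 := hcoord 1
      simp only [hMmax]
      linarith
  /- Step D: the discrepancy tends to `0`. -/
  have hdisc : Tendsto (fun δ => Real.log (P δ (tgt δ) / P δ (aOf δ)) -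
      (ℓ (meshPoint δ (tgt δ)) - ℓ (meshPoint δ (aOf δ)))) (𝓝[>] 0) (𝓝 0) := by
    rw [Metric.tendsto_nhds]
    intro ε hε
    have hcore := eventually_itinerary_estimate hUo hℓ hK hRU hpos (hdiag K hRU hK) (hnn K hRU hK) hTmax0 hMmax0
      (half_pos hε)
    have e1 : ∀ᶠ δ in 𝓝[>] (0 : ℝ), δ ≤ 1 := mem_nhdsWithin_of_mem_nhds (Iic_mem_nhds one_pos)
    have e2 : ∀ᶠ δ in 𝓝[>] (0 : ℝ), δ * (6 * n + 12) ≤ R / 8 := by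
      have h : Tendsto (fun δ : ℝ => δ * (6 * n + 12)) (𝓝[>] 0) (𝓝 0) := by
        have h0 : Tendsto (fun δ : ℝ => δ) (𝓝[>] (0 : ℝ)) (𝓝 0) := tendsto_nhdsWithin_of_tendsto_nhds tendsto_id
        have := h0.mul_const (6 * (n : ℝ) + 12)
        rwa [zero_mul] at this
      exact (h.eventually_lt_const (by positivity : (0 : ℝ) < R / 8)).mono fun δ h => h.le
    have e3 : ∀ᶠ δ in 𝓝[>] (0 : ℝ), ‖y δ - y₀‖ ≤ R / 8 := by
      have := hy (closedBall_mem_nhds y₀ (by positivity : (0 : ℝ) < R / 8))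
      filter_upwards [this] with δ hδ
      have hδ' : y δ ∈ closedBall y₀ (R / 8) := hδ
      rwa [mem_closedBall, dist_eq_norm] at hδ'
    filter_upwards [hcore, e1, e2, e3, self_mem_nhdsWithin] with δ hc h1 h2 h3 hδ0
    obtain ⟨gK, gT, gM⟩ := geo δ hδ0 h1 h2 h3
    have key := hc (aOf δ) (L δ) (hLsteps δ) gK gT gM
    rw [hLsum δ] at key
    rw [dist_zero_right, Real.norm_eq_abs]
    exact key.trans_lt (half_lt_self hε)
  /- Step E: the endpoints. -/
  have hℓc : ContinuousOn ℓ U := hℓ.continuousOn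
  have hmesh_tgt : Tendsto (fun δ => meshPoint δ (tgt δ)) (𝓝[>] 0) (𝓝 y₀) := by
    rw [Metric.tendsto_nhds]
    intro ε hε
    have e1 : ∀ᶠ δ in 𝓝[>] (0 : ℝ), δ < ε / 2 := mem_nhdsWithin_of_mem_nhds (Iio_mem_nhds (half_pos hε))
    have e2 : ∀ᶠ δ in 𝓝[>] (0 : ℝ), dist (y δ) y₀ < ε / 2 := Metric.tendsto_nhds.1 hy _ (half_pos hε)
    filter_upwards [e1, e2, self_mem_nhdsWithin] with δ h1 h2 hδ0
    calc dist (meshPoint δ (tgt δ)) y₀ ≤ dist (meshPoint δ (tgt δ)) (y δ) + dist (y δ) y₀ := dist_triangle _ _ _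
      _ < ε / 2 + ε / 2 := add_lt_add_of_le_of_lt ((dist_meshPoint_nearestSite_le hδ0 (y δ)).trans h1.le) h2
      _ = ε := by ring
  have hmesh_a : Tendsto (fun δ => meshPoint δ (aOf δ)) (𝓝[>] 0) (𝓝 y') := by
    rw [Metric.tendsto_nhds]
    intro ε hε
    have e1 : ∀ᶠ δ in 𝓝[>] (0 : ℝ), δ < ε := mem_nhdsWithin_of_mem_nhds (Iio_mem_nhds hε)
    filter_upwards [e1, self_mem_nhdsWithin] with δ h1 hδ0
    exact (dist_meshPoint_nearestSite_le hδ0 y').trans_lt h1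
  have hℓ_tgt : Tendsto (fun δ => ℓ (meshPoint δ (tgt δ))) (𝓝[>] 0) (𝓝 (ℓ y₀)) :=
    ((hℓc.continuousAt (hUo.mem_nhds hy₀)).tendsto).comp hmesh_tgt
  have hℓ_a : Tendsto (fun δ => ℓ (meshPoint δ (aOf δ))) (𝓝[>] 0) (𝓝 (ℓ y')) :=
    ((hℓc.continuousAt (hUo.mem_nhds hy')).tendsto).comp hmesh_a
  have hlog : Tendsto (fun δ => Real.log (P δ (tgt δ) / P δ (aOf δ))) (𝓝[>] 0) (𝓝 (ℓ y₀ - ℓ y')) := by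
    have h := hdisc.add (hℓ_tgt.sub hℓ_a)
    rw [zero_add] at h
    refine h.congr' (Eventually.of_forall fun δ => ?_)
    ring
  have hexp := (Real.continuous_exp.tendsto _).comp hlog
  refine hexp.congr' ?_
  filter_upwards [hpos] with δ hδ
  simp only [Function.comp, htgt, haOf]
  exact Real.exp_log (div_pos (hδ _) (hδ _))

end LatticeRatio

/-! ### The CHI two-point function: smoothness of `log ⟨σ_x σ_·⟩⁺_Ω` and the ratio limit `hR` -/

section CHI

/-- **The explicit continuum two-point function is `C¹` in the second point** (indeed real-analytic):
`w ↦ log ⟨σ_xσ_w⟩⁺_Ω` (CHI15 (1.2)–(1.3), `twoPointPlusCHI`) is continuously differentiable on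
`Ω ∖ {x}` for a conformal bijection `φ : Ω → ℍ`. [cite: ChelkakHonglerIzyurovAnnals2015, eqs. (1.2)–(1.3) and Remark 2.21] -/
theorem contDiffOn_log_twoPointPlusCHI {Ω : Set ℂ} (hΩo : IsOpen Ω) {φ : ℂ → ℂ}
    (hφ : IsConformalBijection φ Ω UpperHalfPlane.upperHalfPlaneSet) {x : ℂ} (hx : x ∈ Ω) :
    ContDiffOn ℝ 1 (fun w => Real.log (twoPointPlusCHI φ x w)) (Ω \ {x}) := by
  set S := Ω \ {x} with hS
  have hSΩ : S ⊆ Ω := Set.sdiff_subset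
  have hSo : IsOpen S := hΩo.sdiff isClosed_singleton
  have hφan : AnalyticOnNhd ℂ φ Ω := hφ.1.analyticOnNhd hΩo
  have hφC : ContDiffOn ℝ 1 φ S := ((hφan.contDiffOn hΩo.uniqueDiffOn).restrict_scalars ℝ).mono hSΩ
  have hdφC : ContDiffOn ℝ 1 (deriv φ) S := ((hφan.deriv.contDiffOn hΩo.uniqueDiffOn).restrict_scalars ℝ).mono hSΩ
  have him : ∀ w ∈ S, 0 < (φ w).im := fun w hw => hφ.2.mapsTo (hSΩ hw)
  have hφx : 0 < (φ x).im := hφ.2.mapsTo hx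
  have hN0 : ∀ w ∈ S, φ w - φ x ≠ 0 := fun w hw h => hw.2 (hφ.2.injOn (hSΩ hw) hx (sub_eq_zero.1 h))
  have hD0 : ∀ w ∈ S, φ w - (starRingEnd ℂ) (φ x) ≠ 0 := fun w hw h => by
    have h' := congrArg Complex.im (sub_eq_zero.1 h)
    rw [Complex.conj_im] at h'
    linarith [him w hw]
  have hN : ContDiffOn ℝ 1 (fun w => ‖φ w - φ x‖) S := (hφC.sub contDiffOn_const).norm ℝ hN0
  have hD : ContDiffOn ℝ 1 (fun w => ‖φ w - (starRingEnd ℂ) (φ x)‖) S := (hφC.sub contDiffOn_const).norm ℝ hD0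
  have hND0 : ∀ w ∈ S, ‖φ w - φ x‖ / ‖φ w - (starRingEnd ℂ) (φ x)‖ ≠ 0 := fun w hw =>
    div_ne_zero (norm_ne_zero_iff.2 (hN0 w hw)) (norm_ne_zero_iff.2 (hD0 w hw))
  have hu : ContDiffOn ℝ 1 (fun w => uCHI (φ x) (φ w)) S := by
    unfold uCHI
    exact (hN.div hD fun w hw => norm_ne_zero_iff.2 (hD0 w hw)).rpow_const_of_ne hND0
  have hu0 : ∀ w ∈ S, uCHI (φ x) (φ w) ≠ 0 := fun w hw =>
    (uCHI_pos (fun h => hN0 w hw (sub_eq_zero.2 h)) (fun h => hD0 w hw (sub_eq_zero.2 h))).ne'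
  have hG : ContDiffOn ℝ 1 (fun w => uCHI (φ x) (φ w) + (uCHI (φ x) (φ w))⁻¹) S := hu.add (hu.inv hu0)
  have hG0 : ∀ w ∈ S, uCHI (φ x) (φ w) + (uCHI (φ x) (φ w))⁻¹ ≠ 0 := fun w hw => by
    have := uCHI_nonneg (φ x) (φ w)
    have h2 : 0 < uCHI (φ x) (φ w) := lt_of_le_of_ne this (Ne.symm (hu0 w hw))
    positivity
  have hsqrt : ContDiffOn ℝ 1 (fun w => Real.sqrt (uCHI (φ x) (φ w) + (uCHI (φ x) (φ w))⁻¹)) S := hG.sqrt hG0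
  have hIm : ContDiffOn ℝ 1 (fun w => 2 * (φ w).im) S :=
    contDiffOn_const.mul (Complex.imCLM.contDiff.comp_contDiffOn hφC)
  have hIm0 : ∀ w ∈ S, 2 * (φ w).im ≠ 0 := fun w hw => by have := him w hw; positivity
  have hden : ContDiffOn ℝ 1 (fun w => (2 * (φ x).im) ^ ((1 : ℝ) / 8) * (2 * (φ w).im) ^ ((1 : ℝ) / 8)) S :=
    contDiffOn_const.mul (hIm.rpow_const_of_ne hIm0)
  have hden0 : ∀ w ∈ S, (2 * (φ x).im) ^ ((1 : ℝ) / 8) * (2 * (φ w).im) ^ ((1 : ℝ) / 8) ≠ 0 := fun w hw =>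
    mul_ne_zero (Real.rpow_pos_of_pos (by positivity) _).ne' (Real.rpow_pos_of_pos (by have := him w hw; positivity) _).ne'
  have hder0 : ∀ w ∈ S, deriv φ w ≠ 0 := fun w hw =>
    Literature.Analysis.Complex.SCV.deriv_ne_zero_of_injOn hφ.1 hΩo hφ.2.injOn (hSΩ hw)
  have hnum : ContDiffOn ℝ 1 (fun w => ‖deriv φ x‖ ^ ((1 : ℝ) / 8) * ‖deriv φ w‖ ^ ((1 : ℝ) / 8)) S :=
    contDiffOn_const.mul ((hdφC.norm ℝ hder0).rpow_const_of_ne fun w hw => norm_ne_zero_iff.2 (hder0 w hw))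
  have hF : ContDiffOn ℝ 1 (fun w => twoPointPlusCHI φ x w) S := by
    unfold twoPointPlusCHI
    exact (hsqrt.div hden hden0).mul hnum
  exact hF.log fun w hw => (twoPointPlusCHI_pos' hΩo hφ hx (hSΩ hw) (fun h => hw.2 h.symm)).ne'

/-- The lattice two-point function `v ↦ 𝔼⁺_{Ω_δ}[σ_{[x/δ]} σ_v]` is positive (`> 0`) for every mesh
`δ > 0`. [cite: FriedliVelenik2017, Thm. 3.20 (GKS)] -/
theorem meshIsingPlusCorr_meshPoint_pos (Ω : Set ℂ) {δ : ℝ} (hδ : 0 < δ) (x : ℂ) (v : Site 2) :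
    0 < meshIsingPlusCorr Ω δ ![x, meshPoint δ v] := by
  by_cases hv : nearestSite δ x = v
  · -- the diagonal: `σ² = 1`
    have hsame : ∀ i : Fin 2, nearestSite δ (![x, meshPoint δ v] i) = v := by
      intro i
      fin_cases i
      · exact hv
      · exact nearestSite_meshPoint hδ.ne' v
    unfold meshIsingPlusCorr
    have : (spinMonomial fun i => nearestSite δ (![x, meshPoint δ v] i)) = fun _ => (1 : ℝ) := by
      funext σ
      simp only [spinMonomial, hsame, Fin.prod_univ_two, spinAt_mul_self]
    rw [this]
    simp [isingExpect]
  · have hne : nearestSite δ x ≠ nearestSite δ (meshPoint δ v) := by rwa [nearestSite_meshPoint hδ.ne']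
    exact lt_of_lt_of_le (twoPointPlus_pos criticalBetaTwo_pos _) (twoPointPlus_le_meshIsingPlusCorr_two Ω δ hne)

/-- Rounding a rounded point changes nothing: `𝔼⁺[σ_x σ_{δ[z/δ]}] = 𝔼⁺[σ_x σ_z]`. [folklore] -/
theorem meshIsingPlusCorr_meshPoint_nearestSite (Ω : Set ℂ) {δ : ℝ} (hδ : δ ≠ 0) (x z : ℂ) :
    meshIsingPlusCorr Ω δ ![x, meshPoint δ (nearestSite δ z)] = meshIsingPlusCorr Ω δ ![x, z] := by
  unfold meshIsingPlusCorr
  congr 1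
  funext σ
  simp [spinMonomial, Fin.prod_univ_two, nearestSite_meshPoint hδ]

/-- **Hypothesis `hR` of `chi_onePoint_rho_of_ratios` from the convergence of discrete logarithmic
derivatives** (CHI15 Thm 1.5 in the tree's orientation, `hdiag`) **and of nearest-neighbour ratios**
(CHI15 Remark 2.18, `hnn`), for one domain and one base point `x`: if, uniformly over lattice sites
`v` with `δv` in any compact subset of `Ω ∖ {x}`,
`(𝔼⁺[σ_xσ_{v+s}]/𝔼⁺[σ_xσ_v] - 1)/δ → D(log ⟨σ_xσ_·⟩⁺_Ω)(δv)[s]` for the four diagonal steps `s` and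
`𝔼⁺[σ_xσ_{v+e}]/𝔼⁺[σ_xσ_v] → 1` for the four unit steps `e`, then for `y(δ) → y₀` and `y'` in
`Ω ∖ {x}`, `𝔼⁺_{Ω_δ}[σ_xσ_{y(δ)}]/𝔼⁺_{Ω_δ}[σ_xσ_{y'}] → ⟨σ_xσ_{y₀}⟩⁺_Ω/⟨σ_xσ_{y'}⟩⁺_Ω`
(CHI15 Prop 2.20 with Remark 2.21, `k = 1`).
[cite: ChelkakHonglerIzyurovAnnals2015, Prop. 2.20, Remark 2.21, Thm. 1.5, Remark 2.18] -/
theorem tendsto_meshIsingPlusCorr_ratio_of_logDerivative {Ω : Set ℂ} (hΩ : IsAdmissibleDomain Ω) {φ : ℂ → ℂ}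
    (hφ : IsConformalBijection φ Ω UpperHalfPlane.upperHalfPlaneSet) {x : ℂ} (hx : x ∈ Ω)
    (hdiag : ∀ K ⊆ Ω \ {x}, IsCompact K → ∀ s ∈ LatticeRatio.diagSteps, ∀ ε > (0 : ℝ), ∀ᶠ δ in 𝓝[>] (0 : ℝ),
      ∀ v : Site 2, meshPoint δ v ∈ K →
        |(meshIsingPlusCorr Ω δ ![x, meshPoint δ (v + s)] / meshIsingPlusCorr Ω δ ![x, meshPoint δ v] - 1) / δ -
          fderiv ℝ (fun w => Real.log (twoPointPlusCHI φ x w)) (meshPoint δ v) (Site.toComplex s)| < ε)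
    (hnn : ∀ K ⊆ Ω \ {x}, IsCompact K → ∀ s ∈ LatticeRatio.nnSteps, ∀ ε > (0 : ℝ), ∀ᶠ δ in 𝓝[>] (0 : ℝ),
      ∀ v : Site 2, meshPoint δ v ∈ K →
        |meshIsingPlusCorr Ω δ ![x, meshPoint δ (v + s)] / meshIsingPlusCorr Ω δ ![x, meshPoint δ v] - 1| < ε)
    (y : ℝ → ℂ) {y₀ y' : ℂ} (hy₀ : y₀ ∈ Ω) (hy' : y' ∈ Ω) (hy₀x : y₀ ≠ x) (hy'x : y' ≠ x)
    (hy : Tendsto y (𝓝[>] 0) (𝓝 y₀)) :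
    Tendsto (fun δ => meshIsingPlusCorr Ω δ ![x, y δ] / meshIsingPlusCorr Ω δ ![x, y'])
      (𝓝[>] 0) (𝓝 (twoPointPlusCHI φ x y₀ / twoPointPlusCHI φ x y')) := by
  have hΩo : IsOpen Ω := hΩ.1
  have hUc : IsConnected (Ω \ {x}) :=
    ⟨⟨y', hy', hy'x⟩, Literature.Topology.Euclidean.isPreconnected_diff_singleton hΩo
      hΩ.2.2.2.isPathConnected.isConnected.isPreconnected x⟩
  set P : ℝ → Site 2 → ℝ := fun δ v => meshIsingPlusCorr Ω δ ![x, meshPoint δ v] with hP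
  have hpos : ∀ᶠ δ in 𝓝[>] (0 : ℝ), ∀ u, 0 < P δ u := by
    filter_upwards [self_mem_nhdsWithin] with δ hδ u
    exact meshIsingPlusCorr_meshPoint_pos Ω hδ x u
  have key := LatticeRatio.tendsto_ratio_of_logDerivative (hΩo.sdiff isClosed_singleton) hUc
    (contDiffOn_log_twoPointPlusCHI hΩo hφ hx) (P := P) hpos hdiag hnn ⟨hy', hy'x⟩ ⟨hy₀, hy₀x⟩ hy
  have hL0 : 0 < twoPointPlusCHI φ x y₀ := twoPointPlusCHI_pos' hΩo hφ hx hy₀ hy₀x.symm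
  have hL' : 0 < twoPointPlusCHI φ x y' := twoPointPlusCHI_pos' hΩo hφ hx hy' hy'x.symm
  rw [Real.exp_sub, Real.exp_log hL0, Real.exp_log hL'] at key
  refine key.congr' ?_
  filter_upwards [self_mem_nhdsWithin] with δ hδ
  simp only [hP, meshIsingPlusCorr_meshPoint_nearestSite Ω (ne_of_gt hδ)]

/-- **CHI Theorem 1.3 (`k = 0`), i.e. the named fact `chi_onePoint_rho`, from the raw outputs of the
spinor-observable analysis**: the convergence of discrete logarithmic derivatives of the `+`
two-point function along diagonal steps (CHI15 Thm 1.5 in the tree's orientation, with the limit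
written as the derivative of the explicit `log ⟨σ_xσ_·⟩⁺_Ω`, i.e. with Remark 2.21 built in),
nearest-neighbour ratios `→ 1` (Remark 2.18), and the free/plus ratios (Thm 1.7), each for every
admissible approximable domain and every conformal bijection onto `ℍ`. The chain is
`Thm 1.5 & Rem 2.18 ⇒ Prop 2.20` (this file) `& Thm 1.7 ⇒ Thm 1.1` (`PlanarIsingTwoPointProofs`)
`⇒ Thm 1.3, k = 0` (`PlanarIsingOnePointProofs`).
[cite: ChelkakHonglerIzyurovAnnals2015, Thm. 1.5, Remark 2.18, Thm. 1.7, Prop. 2.20, §§2.8–2.10] -/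
theorem chi_onePoint_rho_of_logDerivative
    (hD : ∀ (Ω : Set ℂ), IsAdmissibleDomain Ω → MeshApproximates Ω → ∀ (φ : ℂ → ℂ),
      IsConformalBijection φ Ω UpperHalfPlane.upperHalfPlaneSet → ∀ x ∈ Ω,
        ∀ K ⊆ Ω \ {x}, IsCompact K → ∀ s ∈ LatticeRatio.diagSteps, ∀ ε > (0 : ℝ), ∀ᶠ δ in 𝓝[>] (0 : ℝ),
          ∀ v : Site 2, meshPoint δ v ∈ K →
            |(meshIsingPlusCorr Ω δ ![x, meshPoint δ (v + s)] / meshIsingPlusCorr Ω δ ![x, meshPoint δ v] - 1) / δ -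
              fderiv ℝ (fun w => Real.log (twoPointPlusCHI φ x w)) (meshPoint δ v) (Site.toComplex s)| < ε)
    (hN : ∀ (Ω : Set ℂ), IsAdmissibleDomain Ω → MeshApproximates Ω → ∀ (φ : ℂ → ℂ),
      IsConformalBijection φ Ω UpperHalfPlane.upperHalfPlaneSet → ∀ x ∈ Ω,
        ∀ K ⊆ Ω \ {x}, IsCompact K → ∀ s ∈ LatticeRatio.nnSteps, ∀ ε > (0 : ℝ), ∀ᶠ δ in 𝓝[>] (0 : ℝ),
          ∀ v : Site 2, meshPoint δ v ∈ K →
            |meshIsingPlusCorr Ω δ ![x, meshPoint δ (v + s)] / meshIsingPlusCorr Ω δ ![x, meshPoint δ v] - 1| < ε)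
    (hB : ∀ (Ω : Set ℂ), IsAdmissibleDomain Ω → MeshApproximates Ω → ∀ (φ : ℂ → ℂ),
      IsConformalBijection φ Ω UpperHalfPlane.upperHalfPlaneSet →
        ∀ x ∈ Ω, ∀ (y : ℝ → ℂ) (y₀ : ℂ), y₀ ∈ Ω → y₀ ≠ x → Tendsto y (𝓝[>] 0) (𝓝 y₀) →
          Tendsto (fun δ => meshIsingFreeCorr Ω δ ![x, y δ] / meshIsingPlusCorr Ω δ ![x, y δ])
            (𝓝[>] 0) (𝓝 (bCHI (φ x) (φ y₀)))) :
    chi_onePoint_rho :=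
  chi_onePoint_rho_of_ratios
    (fun Ω hΩ hM φ hφ x hx y _ _ hy₀ hy' hy₀x hy'x hy =>
      tendsto_meshIsingPlusCorr_ratio_of_logDerivative hΩ hφ hx (hD Ω hΩ hM φ hφ x hx) (hN Ω hΩ hM φ hφ x hx)
        y hy₀ hy' hy₀x hy'x hy)
    hB

end CHI

end Literature.Probability.LatticeModels
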